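import Literature.MathematicalPhysics.QuantumFieldTheory.Balaban1983to89.B13Lemma3TorusPrimitivePoly

/-!
# `Balaban1983to89.B13Term214ParamHolo` — T. Bałaban, *Renormalization group approach to lattice gauge field theories. II.
Cluster expansions*, Commun. Math. Phys. **116** (1988) 1–22 [Balaban1988RG2Cluster], p. 15: the term (2.14) is HOLOMORPHIC IN ANY
EXTERNAL COMPLEX PARAMETER ENTERING ONLY THE POTENTIALS `𝐕_k(Y, ·)` OF ITS LAST LINE — from the PRIMITIVE objects of the tree's (2.26)
capstone, with no new estimate

statement-level skeleton of published theorems with citation tags; proofs where landed; nothing here is a claim about the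
Yang–Mills mass gap

CITATION HEADER (verbatim).  P. 15 [PDF 15]: *"To get a bound for H(Z) we consider a term in the sum over 𝐃, P. This term can be
written in the following form:"* (2.14) = `Π_{Δ⊂Z∖Z′₀}∫₀¹ds(Δ)(1/2πi)∮dσ(Δ)/(σ(Δ) − s(Δ))² Π_{Y∈𝐃}∫₀¹dt(Y)(1/2πi)∮dτ(Y)/(τ(Y) − t(Y))²
∫dμ₀(X)|_Z … (−1)^{|P|} χ_{k,Y₀}(B) χᶜ_{k,P}(B) exp[Σ_{Y∈𝐃} τ(Y)𝐕_k(Y, B)]`; *"We consider it as an analytic function of (𝐔, 𝐉) in the space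
𝐔^c_{k+1}(X, α₀, α₁), and of the complex parameters σ(Z), τ"*; p. 11 [PDF 11], Lemma 2 and (1.41): the older terms `E^{(j)}`, `j ≤ k`, of the
effective action enter the step through, and only through, the potentials `𝐕_k(Y, ·)`, LINEARLY ((1.33) → (1.41)); p. 16 [PDF 16] (2.20):
`Σ_{Y∈𝐃} |τ(Y)||𝐕_k(Y, B)| ≦ ½a₂₀‖B‖² + O(1)` — a bound that is blind to the phase of `𝐕_k`.

WHY (cell `pub-ymgap`, Track A node N10 [B13], seat `pub-ymgap-dag-n10-c` g5; count-neutral).  The Summit-side term-level schemas of nodes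
N22 ∕ N18 at the W1 term datum (`Node00/HistoryTermDatum214.TermDatum214.TF` = this display with `𝐕 := 𝒱 Z t s old φ`) ask, per term, for
HOLOMORPHY of the (2.14) term in an external parameter `p` (the complexified OLDER TERMS along a holomorphic curve, (S-226-T) ∕ (H-old); a data
pencil) together with the (2.26) weight bound uniformly in `p`.  The weight half is the tree's (2.26) capstone at each `p`
(`B13Bound226LocatedPoly.norm_term214_le_226_of_primitives_holo_polyτ`, W1-8 `norm_TF_le_weight_of_inputs226Holo`).  THIS FILE supplies the
holomorphy half from THE SAME primitive inputs — the lens memo `ym-lens-BalabanUVNodes-transfer` T11 named it «N10's holomorphic-parameter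
Gaussian ∕ Cauchy device on `core214 ∕ term214`, no new estimate»:
* §1 (the Cauchy device in a parameter, per-domain τ-regions) `differentiableOn_DopC_param`, ★ `differentiableOn_term214_param_polyτ`: if
  every member `Ψ p` of a family of underintegral expressions is separately holomorphic in the `σ(Δ)` on an open `Uσ` and of the poly class
  in the `τ(Y)` on open per-domain regions `Uτ Y` (all containing the closed `r`-discs about `[0, 1]`), and the CORNER VALUES `p ↦ Ψ p σ τ`
  are complex differentiable on `W` for admissible `(σ, τ)`, then `p ↦ term214 r lZ lD (Ψ p) σ₀ τ₀` is complex differentiable on `W` — on `W`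
  the term IS the finite signed double difference of corner values (`B13CauchyDecayPoly.term214_eq_DopC_polyτ`).  (The Literature-side,
  per-domain twin of the Summit-side single-region `Spine/NE5/TwoRunTorusRateCauchy.differentiableOn_term214_param` of seat ne5 — not
  importable here; same five-line device as `B13CauchyDecay.analyticOnNhd_TopC_param`.)
* §2 (the X-integral with the parameter in the potentials, generic letters) `differentiableOn_F214_param`, `differentiableOn_core214_lastLine`:
  at fixed operators `A(σ)`, `Γ(σ)` carrying the (2.15)–(2.23) letters and a fixed `τ`, the X-integral `∫dμ₀(X)|_Z (lines 2–4)` with last line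
  `(−1)^{|P|}χχᶜ exp[Σ τ(Y)𝐕_p(Y, B)]` is holomorphic in `p` on `W` as soon as every `p ↦ 𝐕_p(Y, B)` is, every `𝐕_p(Y, ·)` is measurable, and
  (2.22) + (2.20) hold with letters UNIFORM in `p ∈ W` — ONE application of `B13Core214Holomorphic.differentiableOn_core214X` (any complex
  parameter space; seat ne5) with constant operator families, the Gaussian growth of the last line by `B13Integral223.norm_F214_le`.
* §3 (from the primitive objects, bonds located in an arbitrary site space) `differentiableOn_core214_lastLine_of_primitives` (the letters at
  one `σ` by the capstone's five lines `h216R1_of_factors` → `hR1_of_entrywise`, …, as in `B13Bound226LocatedPoly`), ★★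
  `differentiableOn_term214_of_primitives_polyτ`: THE DEVICE — binder list = `norm_term214_le_226_of_primitives_holo_polyτ`'s with the
  potentials `V p` parametrised (`hVm` for every `p`, `hVd`, (2.20) on the per-domain τ-region uniformly in `p`) and the size-only letters
  (`κ₁ ≥ 1`, the τ-radii, `g ≥ 0`) dropped; σ-slot by `B13Core214HolomorphicPrimitive.sepHolOn_core214_sigma_of_primitives`, τ-slot by
  `B13Bound226LocatedPoly.sepHolOnPoly_core214_tau_of_primitives`, parameter slot by §3's first theorem, at each corner.
* §4 (torus edition) ★ `differentiableOn_term214_torus_of_primitives_holo_polyτ` — keyed like `B13Lemma3TorusPrimitivePoly.h226_torus_of_primitives_holo_polyτ`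
  (bonds on [13]'s site torus `UT Nf`, weight `d₁`, lattice constant `(1 + 2/b)^ν`), base points `σ = 0`, `τ = 0`; the W1-datum edition
  (`TermDatum214.TF` along an older-terms curve) is one application.

v1.1 (same seat, 2026-08-27; APPEND-ONLY): §5–§7 — the parameter may ALSO enter the KERNELS: `differentiableOn_core214_param_of_primitives`
(the parameter slot at one σ with `A_p(σ)`, `G_p(σ)` p-holomorphic and the σ-letters uniform in `p`), ★
`differentiableOn_term214_param_of_primitives_polyτ` (the term with `A_p`, `Γ_p`, `G_p`, `𝐕_p` all parametrised; §3 = the case of p-free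
kernels), `differentiableOn_term214_torus_param_of_primitives_holo_polyτ` (torus edition) — the «corner values holomorphic in the step's
DATA» hypothesis of node N18's `…N18HLayerDatumCauchy` and NE5's pencil hypothesis (`TwoRunTorusRateCauchy.pencil_hol_of_corners`) from
PRIMITIVE letters uniform on the parameter set.  No statement of v1 changed.  PRIOR ART IN THE TREE (Summit-side, cell `pub-balaban-gaps`, seat ne5
gen 8; not importable into Literature and therefore twinned here, not restated as new mathematics): `Spine/NE5/TwoRunTorusPrimitiveParam` — its §0
`differentiableOn_term214_param_polyτ` is the namesake and statement twin of §1 here, its §1 `differentiableOn_core214_of_primitives_param` of §5, and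
its §2 `hol_and_h226_torus_of_primitives_param` (holomorphy half) of §7; §3–§4 of v1 are the special case of parameter-free kernels.  The Literature
placement is what W1's term-datum modules (`Node00/HistoryTermDatum214*`, the edition `B13TermDatum214ParamHolo`) and other Literature consumers can
import; node N18's Summit-side files already consume the ne5 engine (`…N18HLayerW1TermAnalytic`).

HONEST FRAMING.  Generic finite-dimensional complex analysis over the block model of record; every kernel family, every letter and the
parameter-dependence of the potentials are HYPOTHESES (print's LAW — 𝐕_k a finite linear combination of evaluations of the older terms,
(1.33)–(1.41) — is not typed here; under it `hVd` is coordinatewise holomorphy of the older-terms curve); nothing of Bałaban's `Γ_k(Z₀,σ)`,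
`C^{(k)}(Z₀,σ)`, `χ`, `𝐕_k` is constructed or asserted; nodes N10 ∕ N18 ∕ N22 NOT discharged; one finite 𝕋⁴ programme at fixed ε — NOT continuum,
NOT infinite volume, NOT OS, NOT mass gap, NOT Clay.  0 sorry, 0 `def` (one private plumbing lemma), standard axioms.
-/

noncomputable section

namespace Literature.MathematicalPhysics.QuantumFieldTheory.Balaban1983to89.B13Term214ParamHolo

open Matrix MeasureTheory Finset Complex Metric Set
open scoped Real
open B13PerturbativeStep (WeightHyp)
open B13Term214 (cornerC DopC TopC SepHolOn term214 core214 F214 integrand214 cgaussMean)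
open B13Eq216FirstForm (hdef1_of_linear)
open B13Bound226Primitive (hdef3_of_linear h216R3_of_diff continuous_of_linear)
open B13Bound226Located (h216R1_of_factors hR1_of_entrywise hR2_of_entrywise hR3_of_entrywise h17a_of_entrywise
  h17b_of_entrywise entry_bound_mono_rate kc_l1_nonneg)
open B13Integral223 (norm_F214_le)
open B13Core214Holomorphic (measurable_F214 differentiableOn_core214X)
open B13Core214HolomorphicPrimitive (sepHolOn_core214_sigma_of_primitives)
open B13CauchyDecayPoly (SepHolOnPoly term214_eq_DopC_polyτ)
open B13CauchyDecay (closedBall_subset_closedBall_of_mem_uIcc)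
open B13Bound226LocatedPoly (sepHolOnPoly_core214_tau_of_primitives)
open B13Lemma3TorusPrimitive (weightHyp_tdist1 tdist1_symm kc_tdist1)
open TreeLengthTorus (TPt TDom)
open B5TorusCover (UT)
open B9Thm37GlueTorus (tdist1)

/-! ## §1. The Cauchy device (2.14) in an external parameter, per-domain τ-regions -/

section Param

variable {E : Type*} [NormedAddCommGroup E] [NormedSpace ℂ E]
variable {ι : Type*} [DecidableEq ι] {κ : Type*} [DecidableEq κ]
variable {P : Type*} [NormedAddCommGroup P] [NormedSpace ℂ P]

/-- Corners of `{0,1}^S` over a base point of the per-coordinate regions (`0, 1` in every region) have their coordinates in the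
regions (plumbing; the statement of the private lemma of `B13CauchyDecayPoly`).
[cite: Balaban1988RG2Cluster, (2.14) p.15] (elementary API for (2.14)) -/
private theorem cornerC_mem_poly {U : ι → Set ℂ} (S T : Finset ι) (h0 : ∀ j, (0 : ℂ) ∈ U j) (h1 : ∀ j, (1 : ℂ) ∈ U j)
    {p : ι → ℂ} (hp : ∀ j, p j ∈ U j) (j : ι) : cornerC S T p j ∈ U j := by
  unfold cornerC
  split_ifs
  · exact h1 j
  · exact h0 j
  · exact hp j

/-- **The iterated difference in a parameter**: `p ↦ DopC S (Φ p) q` is complex differentiable on `W` as soon as every corner value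
`p ↦ Φ p (corner S T q)` is — it is their finite signed sum (the `DifferentiableOn` face of `B13CauchyDecay.analyticOnNhd_DopC_param`).
[cite: Balaban1988RG2Cluster, (2.14) p.15] (elementary API for (2.14)) -/
theorem differentiableOn_DopC_param {W : Set P} {Φ : P → (ι → ℂ) → E} (S : Finset ι) (q : ι → ℂ)
    (hΦ : ∀ T ∈ S.powerset, DifferentiableOn ℂ (fun p => Φ p (cornerC S T q)) W) :
    DifferentiableOn ℂ (fun p => DopC S (Φ p) q) W := by
  have key : (fun p => DopC S (Φ p) q)
      = fun p => ∑ T ∈ S.powerset, ((-1 : ℂ) ^ (S \ T).card) • Φ p (cornerC S T q) := rfl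
  rw [key]
  exact DifferentiableOn.fun_sum fun T hT => (hΦ T hT).const_smul _

/-- **THE TERM (2.14) IS HOLOMORPHIC IN ANY EXTERNAL COMPLEX PARAMETER THROUGH ITS CORNER VALUES, per-domain τ-regions.**  A family
`Ψ p` (`p ∈ W ⊆ P`, any complex normed space) of underintegral expressions, each separately holomorphic in the `σ(Δ)` on one open `Uσ`
(for every τ of the regions) and of the poly class in the `τ(Y)` on open per-domain regions `Uτ Y` (for every σ of `Uσ`), all regions
containing the closed `r`-discs about `[0, 1]`; the CORNER VALUES `p ↦ Ψ p σ τ` complex differentiable on `W` for all admissible `(σ, τ)`.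
Then `p ↦ term214 r lZ lD (Ψ p) σ₀ τ₀` (distinct parameters, base points in the regions) is complex differentiable on `W` — on `W` the
term IS the finite signed double difference `D^σ_{lZ} D^τ_{lD} Ψ p` of corner values (`B13CauchyDecayPoly.term214_eq_DopC_polyτ`); no joint
analyticity in `(p, σ, τ)` is needed.  (Per-domain twin of the Summit-side `Spine/NE5/TwoRunTorusRateCauchy.differentiableOn_term214_param`.)
[cite: Balaban1988RG2Cluster, (2.14) p.15 and (2.18) p.16] -/
theorem differentiableOn_term214_param_polyτ [CompleteSpace E] {Uσ : Set ℂ} {Uτ : κ → Set ℂ}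
    (hUσ : IsOpen Uσ) (hUτ : ∀ Y, IsOpen (Uτ Y)) {r : ℝ} (hr : 0 < r)
    (hsubσ : ∀ s ∈ Set.uIcc (0 : ℝ) 1, closedBall (s : ℂ) r ⊆ Uσ)
    (hsubτ : ∀ Y, ∀ s ∈ Set.uIcc (0 : ℝ) 1, closedBall (s : ℂ) r ⊆ Uτ Y) {W : Set P}
    {Ψ : P → (ι → ℂ) → (κ → ℂ) → E}
    (hΨσ : ∀ p ∈ W, ∀ τ : κ → ℂ, (∀ j, τ j ∈ Uτ j) → SepHolOn Uσ (fun σ => Ψ p σ τ))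
    (hΨτ : ∀ p ∈ W, ∀ σ : ι → ℂ, (∀ j, σ j ∈ Uσ) → SepHolOnPoly Uτ (fun τ => Ψ p σ τ))
    (hpt : ∀ (σ : ι → ℂ) (τ : κ → ℂ), (∀ j, σ j ∈ Uσ) → (∀ j, τ j ∈ Uτ j) →
      DifferentiableOn ℂ (fun p => Ψ p σ τ) W)
    {lZ : List ι} (hlZ : lZ.Nodup) {lD : List κ} (hlD : lD.Nodup) {σ₀ : ι → ℂ} (hσ₀ : ∀ j, σ₀ j ∈ Uσ)
    {τ₀ : κ → ℂ} (hτ₀ : ∀ j, τ₀ j ∈ Uτ j) :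
    DifferentiableOn ℂ (fun p => term214 r lZ lD (Ψ p) σ₀ τ₀) W := by
  have h0σ : (0 : ℂ) ∈ Uσ := by simpa using hsubσ 0 (by simp) (mem_closedBall_self hr.le)
  have h1σ : (1 : ℂ) ∈ Uσ := by simpa using hsubσ 1 (by simp) (mem_closedBall_self hr.le)
  have h0τ : ∀ Y, (0 : ℂ) ∈ Uτ Y := fun Y => by
    simpa using hsubτ Y 0 (by simp) (mem_closedBall_self hr.le)
  have h1τ : ∀ Y, (1 : ℂ) ∈ Uτ Y := fun Y => by
    simpa using hsubτ Y 1 (by simp) (mem_closedBall_self hr.le)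
  -- on `W` the Cauchy form is the double difference form
  have heq : ∀ p ∈ W, term214 r lZ lD (Ψ p) σ₀ τ₀ =
      DopC lZ.toFinset (fun σ => DopC lD.toFinset (fun τ => Ψ p σ τ) τ₀) σ₀ := fun p hp =>
    term214_eq_DopC_polyτ hUσ hUτ hr hsubσ hsubτ (hΨσ p hp) (hΨτ p hp) hlZ hlD hσ₀ hτ₀
  -- the double difference form is a finite signed sum of corner values, each differentiable in `p`
  have hD : DifferentiableOn ℂ
      (fun p => DopC lZ.toFinset (fun σ => DopC lD.toFinset (fun τ => Ψ p σ τ) τ₀) σ₀) W := by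
    refine differentiableOn_DopC_param (Φ := fun p σ => DopC lD.toFinset (fun τ => Ψ p σ τ) τ₀) lZ.toFinset σ₀
      fun T _ => ?_
    refine differentiableOn_DopC_param (Φ := fun p τ => Ψ p (cornerC lZ.toFinset T σ₀) τ) lD.toFinset τ₀
      fun T' _ => ?_
    exact hpt _ _ (cornerC_mem_poly (U := fun _ => Uσ) _ T (fun _ => h0σ) (fun _ => h1σ) hσ₀)
      (cornerC_mem_poly _ T' h0τ h1τ hτ₀)
  exact hD.congr heq

end Param

/-! ## §2. The X-integral of (2.14) with the parameter in the potentials, generic (2.15)–(2.23) letters -/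

section LastLine

variable {Λ C₀ : Type} [Fintype Λ] [DecidableEq Λ] [Fintype C₀] [DecidableEq C₀]
variable {P : Type*} [NormedAddCommGroup P] [NormedSpace ℂ P] {W : Set P}
variable {D : Type*}

omit [Fintype Λ] [DecidableEq Λ] in
/-- **The printed last line with parameter-dependent potentials is holomorphic in the parameter** at every field and every `τ`:
`p ↦ (−1)^{|P|}χ_{k,Y₀}(B)χᶜ_{k,P}(B) exp[Σ_{Y∈𝐃} τ(Y)𝐕_p(Y,B)]` (`B13Term214.F214`) is complex differentiable on `W` when every
`p ↦ 𝐕_p(Y, B)` is. [cite: Balaban1988RG2Cluster, (2.14) p.15 and (1.41) p.11] -/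
theorem differentiableOn_F214_param (cardP : ℕ) (χY₀ χcP : (Λ → ℝ) → ℝ) (Dfam : Finset D)
    {Vk : P → D → (Λ → ℝ) → ℂ} (τ : D → ℂ) (B : Λ → ℝ) (hVd : ∀ Y, DifferentiableOn ℂ (fun p => Vk p Y B) W) :
    DifferentiableOn ℂ (fun p => F214 cardP χY₀ χcP Dfam (Vk p) τ B) W := by
  unfold F214
  have h : DifferentiableOn ℂ (fun p => ∑ Y ∈ Dfam, τ Y * Vk p Y B) W :=
    DifferentiableOn.fun_sum fun Y _ => (differentiableOn_const (τ Y)).mul (hVd Y)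
  exact (differentiableOn_const ((-1 : ℂ) ^ cardP * (χY₀ B : ℂ) * (χcP B : ℂ))).mul h.cexp

variable {C : Matrix Λ Λ ℝ} {Γ₀ : Matrix Λ (Λ ⊕ C₀) ℝ} {ρ c g η : ℝ}

/-- **THE X-INTEGRAL OF (2.14) IS HOLOMORPHIC IN A PARAMETER ENTERING ONLY THE POTENTIALS, generic letters.**  At a fixed `σ` (operators
`A(σ)`, `Γ(σ)` fixed, with the (2.15)–(2.23) letters at that `σ`: `R₁`, (2.17) twice, `R₂`, `R₃`, `λ_k(C) ≤ c`, `α₅c ≤ ½`, `⟨Γ₀X, CΓ₀X⟩ ≤ g‖X‖²`,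
`α₅(1 + 2cg) < 1`, `α₅ = 2ρ + γ₂ + a₂₀`) and a fixed `τ`, let the potentials depend on a parameter `p` of an open `W` of any complex normed
space: `p ↦ 𝐕_p(Y, B)` complex differentiable on `W` for every `(Y, B)`, `𝐕_p(Y, ·)` measurable, the characteristic functions measurable,
non-negative with (2.22), and (2.20) AT THIS `τ` UNIFORMLY IN `p ∈ W` (`Σ_{Y∈𝐃}|τ(Y)|‖𝐕_p(Y,B)‖ ≤ ½a₂₀‖B‖² + w`).  Then
`p ↦ ∫dμ₀(X)|_Z (lines 2–4 of (2.14))` = `core214 A Γ (F214 |P| χ χᶜ 𝐃 𝐕_p) σ τ` is complex differentiable on `W` — holomorphy under the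
integral sign, `B13Core214Holomorphic.differentiableOn_core214X` with constant operator families and the last line's Gaussian growth
`‖F‖ ≤ e^{−½γ₂r_P²|P| + w}e^{½(γ₂ + a₂₀)‖B‖²}` (`B13Integral223.norm_F214_le`), uniform in `p`. [cite: Balaban1988RG2Cluster, (2.14)–(2.15) p.15, (2.16)–(2.22) p.16, (2.23)–(2.25) p.17] -/
theorem differentiableOn_core214_lastLine [Fintype D] [DecidableEq D] (hW : IsOpen W) {ι : Type*}
    {Aσ : (ι → ℂ) → Matrix Λ Λ ℂ} {Γσ : (ι → ℂ) → (Λ ⊕ C₀ → ℝ) → (Λ → ℂ)} (σ : ι → ℂ)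
    (hAs : (Aσ σ).IsSymm) (hApos : ((Aσ σ).map Complex.re).PosDef) (hΓc : Continuous (Γσ σ))
    (cardP : ℕ) {χY₀ χcP : (Λ → ℝ) → ℝ} (hχm : Measurable χY₀) (hχcm : Measurable χcP)
    (hχ0 : ∀ B, 0 ≤ χY₀ B) (hχc0 : ∀ B, 0 ≤ χcP B) (Dfam : Finset D) {Vk : P → D → (Λ → ℝ) → ℂ}
    (hVm : ∀ p ∈ W, ∀ Y, Measurable (Vk p Y)) (hVd : ∀ Y B, DifferentiableOn ℂ (fun p => Vk p Y B) W)
    (τ : D → ℂ) {γ₂ rP a₂₀ w : ℝ} (qP : (Λ → ℝ) → ℝ)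
    (h222 : ∀ B, χY₀ B * χcP B ≤ Real.exp (-(γ₂ / 2 * rP ^ 2 * cardP) + γ₂ / 2 * qP B)) (hγ₂ : 0 ≤ γ₂)
    (hqP : ∀ B, qP B ≤ B ⬝ᵥ B) (ha₂₀ : 0 ≤ a₂₀)
    (h220 : ∀ p ∈ W, ∀ B, ∑ Y ∈ Dfam, ‖τ Y‖ * ‖Vk p Y B‖ ≤ a₂₀ / 2 * (B ⬝ᵥ B) + w)
    (hC : C.PosDef) (hρ0 : 0 ≤ ρ)
    (hR1 : ∀ X : Λ ⊕ C₀ → ℝ, -(1 / 2) * ((Γσ σ X) ⬝ᵥ ((Aσ σ)⁻¹ *ᵥ Γσ σ X)).re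
      ≤ -(1 / 2 * ((Γ₀ *ᵥ X) ⬝ᵥ (C *ᵥ (Γ₀ *ᵥ X)))) + ρ / 2 * (X ⬝ᵥ X))
    (h17a : Real.sqrt (‖(Aσ σ).det‖ / ((Aσ σ).map Complex.re).det) ≤ Real.exp (η * Fintype.card Λ))
    (h17b : Real.sqrt (((Aσ σ).map Complex.re).det / C⁻¹.det) ≤ Real.exp (η * Fintype.card Λ))
    (hR2 : ∀ B : Λ → ℝ, B ⬝ᵥ ((C⁻¹ - (Aσ σ).map Complex.re) *ᵥ B) ≤ ρ * (B ⬝ᵥ B))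
    (hR3 : ∀ (X : Λ ⊕ C₀ → ℝ) (B : Λ → ℝ), -(B ⬝ᵥ fun i => (Γσ σ X i).re)
      ≤ -(B ⬝ᵥ (Γ₀ *ᵥ X)) + ρ / 2 * (X ⬝ᵥ X + B ⬝ᵥ B))
    (hc0 : 0 ≤ c) (hc : ∀ k, hC.1.eigenvalues k ≤ c) (hαc : (2 * ρ + (γ₂ + a₂₀)) * c ≤ 1 / 2)
    (hΓ0 : ∀ X : Λ ⊕ C₀ → ℝ, (Γ₀ *ᵥ X) ⬝ᵥ (C *ᵥ (Γ₀ *ᵥ X)) ≤ g * (X ⬝ᵥ X))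
    (hsmall : (2 * ρ + (γ₂ + a₂₀)) * (1 + 2 * c * g) < 1) :
    DifferentiableOn ℂ (fun p => core214 Aσ Γσ (F214 cardP χY₀ χcP Dfam (Vk p)) σ τ) W := by
  unfold core214
  refine differentiableOn_core214X (A := fun _ => Aσ σ) (Γ := fun _ => Γσ σ)
    (F := fun p => F214 cardP χY₀ χcP Dfam (Vk p) τ) (K := Real.exp (-(γ₂ / 2 * rP ^ 2 * cardP) + w)) hW
    (fun i j => differentiableOn_const _) (fun _ _ => hAs) (fun _ _ => hApos) (fun X i => differentiableOn_const _)
    (fun _ _ => hΓc) (fun B => differentiableOn_F214_param cardP χY₀ χcP Dfam τ B fun Y => hVd Y B)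
    (fun p hp => (measurable_F214 cardP hχm hχcm Dfam (hVm p hp) τ).stronglyMeasurable) hC hρ0 (by positivity)
    (Real.exp_pos _).le (fun _ _ => hR1) (fun _ _ => h17a) (fun _ _ => h17b) (fun _ _ => hR2) (fun _ _ => hR3)
    (fun p hp B => ?_) hc0 hc hαc hΓ0 hsmall
  exact norm_F214_le cardP χY₀ χcP Dfam (Vk p) τ qP B (hχ0 B) (hχc0 B) (h222 B) hγ₂ (hqP B) (h220 p hp B)

end LastLine

/-! ## §3. From the primitive objects, bonds located in an arbitrary site space -/

section Located

variable {S : Type*} [DecidableEq S] {ρ : S → S → ℝ} {Kc : ℝ → ℝ}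
variable {Λ : Type} [Fintype Λ] [DecidableEq Λ] {C₀ : Type} [Fintype C₀] [DecidableEq C₀]
variable {ι κ : Type*} [Fintype ι] [DecidableEq ι] [Fintype κ] [DecidableEq κ]
variable {P : Type*} [NormedAddCommGroup P] [NormedSpace ℂ P] {W : Set P}

omit [Fintype ι] [DecidableEq ι] in
/-- **THE PARAMETER SLOT FROM THE PRIMITIVE OBJECTS, at one `σ`**: located index set `S` with weight `ρ` and lattice constant `Kc`
(`B13Bound226Located`); bonds of `Z₀` (`Λ`) and of `Z` (`Λ ⊕ C₀`) located with `≤ m` per site; at the given `σ`: `A(σ)` symmetric with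
`Re A(σ) ≻ 0`, the Γ-operator linear with kernel `G(σ)`, the localisation letters `K_G, K_Γ, K_{Cσ}, K₀` at rate `κ` and the (2.16)-type
difference letters `θ_Γ, θ_C, θ_E`, rates `κ > κ′ > κ″ > 0`, the common majorant `θ`, `K′θ′ < 1`, `α₅c ≤ ½`, `⟨Γ₀X, CΓ₀X⟩ ≤ g‖X‖²`,
`α₅(1 + 2cg) ≤ ½` (`α₅ = 2θ·mKc(κ″) + γ₂ + a`); the last line: characteristic functions measurable, non-negative with (2.22); potentials
`𝐕_p(Y, ·)` measurable, `p ↦ 𝐕_p(Y, B)` complex differentiable on the open `W`, and (2.20) at the given `τ` uniformly in `p ∈ W`.  Conclusion: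
`p ↦ core214 A Γ (F214 |P| χ χᶜ 𝐃 𝐕_p) σ τ` is complex differentiable on `W` (§2 with the letters derived by the capstone's five lines).
[cite: Balaban1988RG2Cluster, (2.14)–(2.15) p.15, (2.16)–(2.22) p.16, (2.23)–(2.25) p.17] -/
theorem differentiableOn_core214_lastLine_of_primitives (hρ : WeightHyp 0 ρ) (hρs : ∀ x y : S, ρ x y = ρ y x)
    (hKc : ∀ b : ℝ, 0 < b → ∀ (T : Finset S) (x : S), ∑ y ∈ T, Real.exp (-(b * ρ x y)) ≤ Kc b)
    (hKc0 : ∀ b : ℝ, 0 < b → 0 ≤ Kc b) (hW : IsOpen W)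
    (A : (ι → ℂ) → Matrix Λ Λ ℂ) (Γ : (ι → ℂ) → (Λ ⊕ C₀ → ℝ) → (Λ → ℂ)) (G : (ι → ℂ) → Matrix Λ (Λ ⊕ C₀) ℂ)
    (σ : ι → ℂ) (hAs : (A σ).IsSymm) (hA : ((A σ).map Complex.re).PosDef)
    (hlin : ∀ X : Λ ⊕ C₀ → ℝ, Γ σ X = G σ *ᵥ fun j => (X j : ℂ))
    (cardP : ℕ) {χY₀ χcP : (Λ → ℝ) → ℝ} (hχm : Measurable χY₀) (hχcm : Measurable χcP)
    (hχ0 : ∀ B, 0 ≤ χY₀ B) (hχc0 : ∀ B, 0 ≤ χcP B) (Dfam : Finset κ) {V : P → κ → (Λ → ℝ) → ℂ}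
    (hVm : ∀ p ∈ W, ∀ Y, Measurable (V p Y)) (hVd : ∀ Y B, DifferentiableOn ℂ (fun p => V p Y B) W)
    (τ : κ → ℂ) {γ₂ rP a w : ℝ} (qP : (Λ → ℝ) → ℝ)
    (h222 : ∀ B, χY₀ B * χcP B ≤ Real.exp (-(γ₂ / 2 * rP ^ 2 * cardP) + γ₂ / 2 * qP B)) (hγ₂ : 0 ≤ γ₂)
    (hqP : ∀ B, qP B ≤ B ⬝ᵥ B) (ha0 : 0 ≤ a)
    (h220 : ∀ p ∈ W, ∀ B, ∑ Y ∈ Dfam, ‖τ Y‖ * ‖V p Y B‖ ≤ a / 2 * (B ⬝ᵥ B) + w)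
    {C : Matrix Λ Λ ℝ} (hC : C.PosDef) (Γ₀ : Matrix Λ (Λ ⊕ C₀) ℝ)
    (locΛ : Λ → S) (locN : Λ ⊕ C₀ → S) {m : ℕ}
    (hfibΛ : ∀ x : S, (Finset.univ.filter fun i => locΛ i = x).card ≤ m)
    (hfibN : ∀ x : S, (Finset.univ.filter fun j => locN j = x).card ≤ m)
    {kap kap' kap'' θ θE θΓ θC KG KΓ KCs K₀ : ℝ} (hkap'' : 0 < kap'') (h1 : kap'' < kap') (h2 : kap' < kap)
    (hθE : 0 ≤ θE) (hθΓ : 0 ≤ θΓ) (hθC : 0 ≤ θC) (hKG : 0 ≤ KG) (hKΓ : 0 ≤ KΓ) (hKCs : 0 ≤ KCs) (hK₀ : 0 ≤ K₀)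
    (hθEle : θE ≤ θ) (hθΓle : θΓ ≤ θ)
    (hθR1le : (m * Kc (kap - kap')) * (m * Kc (kap' - kap''))
      * (θΓ * KCs * KG + KΓ * θC * KG + KΓ * K₀ * θΓ) ≤ θ)
    (hG : ∀ b j, ‖G σ b j‖ ≤ KG * Real.exp (-(kap * ρ (locΛ b) (locN j))))
    (hΓ₀ : ∀ b j, ‖Γ₀ b j‖ ≤ KΓ * Real.exp (-(kap * ρ (locΛ b) (locN j))))
    (hCs : ∀ b b', ‖(A σ)⁻¹ b b'‖ ≤ KCs * Real.exp (-(kap * ρ (locΛ b) (locΛ b'))))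
    (hC216 : ∀ b b', ‖C b b'‖ ≤ K₀ * Real.exp (-(kap * ρ (locΛ b) (locΛ b'))))
    (hdΓ : ∀ b j, ‖(G σ - Γ₀.map (algebraMap ℝ ℂ)) b j‖ ≤ θΓ * Real.exp (-(kap * ρ (locΛ b) (locN j))))
    (hdC : ∀ b b', ‖((A σ)⁻¹ - C.map (algebraMap ℝ ℂ)) b b'‖ ≤ θC * Real.exp (-(kap * ρ (locΛ b) (locΛ b'))))
    (hdE : ∀ b b', ‖(A σ - C⁻¹.map (algebraMap ℝ ℂ)) b b'‖ ≤ θE * Real.exp (-(kap * ρ (locΛ b) (locΛ b'))))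
    (hsmallKθ : K₀ * (m * Kc kap) * (θ * (m * Kc kap'')) < 1)
    {c g : ℝ} (hc0 : 0 ≤ c) (hc : ∀ k, hC.1.eigenvalues k ≤ c)
    (hαc : (2 * (θ * (m * Kc kap'')) + (γ₂ + a)) * c ≤ 1 / 2)
    (hΓq : ∀ X : Λ ⊕ C₀ → ℝ, (Γ₀ *ᵥ X) ⬝ᵥ (C *ᵥ (Γ₀ *ᵥ X)) ≤ g * (X ⬝ᵥ X))
    (hsmall : (2 * (θ * (m * Kc kap'')) + (γ₂ + a)) * (1 + 2 * c * g) ≤ 1 / 2) :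
    DifferentiableOn ℂ (fun p => core214 A Γ (F214 cardP χY₀ χcP Dfam (V p)) σ τ) W := by
  have hθ : 0 ≤ θ := hθE.trans hθEle
  have hkap : 0 < kap := hkap''.trans (h1.trans h2)
  have hkk : kap'' ≤ kap := (h1.trans h2).le
  have hρ0 : 0 ≤ θ * (m * Kc kap'') := mul_nonneg hθ (mul_nonneg (Nat.cast_nonneg m) (hKc0 _ hkap''))
  -- entrywise (2.16) for R₁(σ), E(σ), R₃(σ) at this σ
  have h216R1 : ∀ b b', ‖(Γ₀ᵀ * C * Γ₀ - ((G σ)ᵀ * (A σ)⁻¹ * G σ).map Complex.re) b b'‖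
      ≤ θ * Real.exp (-(kap'' * ρ (locN b) (locN b'))) := fun b b' =>
    (h216R1_of_factors hρ hρs hKc hKc0 hθΓ hθC hKG hKΓ hKCs hK₀ hkap''.le h1 h2 locΛ locN hfibΛ
      hdΓ hdC hG hΓ₀ hCs hC216 b b').trans (mul_le_mul_of_nonneg_right hθR1le (Real.exp_pos _).le)
  have h216E : ∀ b b', ‖(A σ - C⁻¹.map (algebraMap ℝ ℂ)) b b'‖ ≤ θ * Real.exp (-(kap'' * ρ (locΛ b) (locΛ b'))) :=
    fun b b' => (entry_bound_mono_rate hρ hθE hkk locΛ locΛ hdE b b').trans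
      (mul_le_mul_of_nonneg_right hθEle (Real.exp_pos _).le)
  have h216R3 : ∀ i j, ‖((G σ).map Complex.re - Γ₀) i j‖ ≤ θ * Real.exp (-(kap'' * ρ (locΛ i) (locN j))) := by
    have hmono : ∀ i j, ‖(G σ - Γ₀.map (algebraMap ℝ ℂ)) i j‖ ≤ θ * Real.exp (-(kap'' * ρ (locΛ i) (locN j))) :=
      fun i j => (entry_bound_mono_rate hρ hθΓ hkk locΛ locN hdΓ i j).trans
        (mul_le_mul_of_nonneg_right hθΓle (Real.exp_pos _).le)
    exact fun i j => h216R3_of_diff hmono i j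
  exact differentiableOn_core214_lastLine (ρ := θ * (m * Kc kap''))
    (η := K₀ * (m * Kc kap) * (θ * (m * Kc kap'')) * (1 + (1 - K₀ * (m * Kc kap) * (θ * (m * Kc kap'')))⁻¹) / 2)
    (g := g) (Γ₀ := Γ₀) hW σ hAs hA (continuous_of_linear (G σ) (Γ σ) hlin) cardP hχm hχcm hχ0 hχc0 Dfam hVm hVd τ qP
    h222 hγ₂ hqP ha0 h220 hC hρ0
    (fun X => hR1_of_entrywise hρ hρs hKc (Γ σ) Γ₀ _ hθ hkap'' locN hfibN
      (hdef1_of_linear (A σ) (G σ) (Γ σ) hlin C Γ₀) h216R1 X)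
    (h17a_of_entrywise hρ hρs hKc hC hA hθ hkap'' hK₀ hkap locΛ hfibΛ hC216 h216E hsmallKθ)
    (h17b_of_entrywise hρ hρs hKc hC hA hθ hkap'' hK₀ hkap locΛ hfibΛ hC216 h216E hsmallKθ)
    (fun B => hR2_of_entrywise hρ hρs hKc hθ hkap'' locΛ hfibΛ h216E B)
    (fun X B => hR3_of_entrywise hρs hKc (Γ σ) Γ₀ _ hθ hkap'' locΛ locN hfibΛ hfibN
      (hdef3_of_linear (G σ) (Γ σ) hlin Γ₀) h216R3 X B)
    hc0 hc hαc hΓq (lt_of_le_of_lt hsmall (by norm_num))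

/-- **THE TERM (2.14) IS HOLOMORPHIC IN ANY EXTERNAL PARAMETER ENTERING ONLY THE POTENTIALS — from the primitive objects, per-domain
τ-regions.**  The binders of the tree's (2.26) capstone `B13Bound226LocatedPoly.norm_term214_le_226_of_primitives_holo_polyτ` (located
index set; an open `Uσ` and open per-domain regions `Uτ Y`, all containing the closed `r`-discs about `[0, 1]`; the σ-letters on the open
σ-polydisc `{σ | ∀ j, σ j ∈ Uσ}`: `A(σ)` symmetric with `Re A(σ) ≻ 0`, entrywise holomorphic, the Γ-operator linear with an entrywise
holomorphic kernel `G(σ)`, the localisation letters (L17a) and the (2.16)-type difference letters (L16a), rates, the common majorant, the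
(2.24)–(2.25) smallness; the characteristic functions measurable, non-negative with (2.22)) — with the POTENTIALS PARAMETRISED by `p` of an
open `W` of any complex normed space: `𝐕_p(Y, ·)` measurable for `p ∈ W`, `p ↦ 𝐕_p(Y, B)` complex differentiable on `W`, and (2.20) on the
per-domain τ-region UNIFORMLY in `p ∈ W`; the size-only letters of the capstone (`κ₁ ≥ 1`, the τ-radii, `g ≥ 0`) are not needed.  Conclusion:
`p ↦ term214 r lZ lD (core214 A Γ (F214 |P| χ χᶜ 𝐃 𝐕_p)) σ₀ τ₀` is complex differentiable on `W` (base points in the regions) — §1 with the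
σ-slot (`B13Core214HolomorphicPrimitive.sepHolOn_core214_sigma_of_primitives`) and the τ-slot
(`B13Bound226LocatedPoly.sepHolOnPoly_core214_tau_of_primitives`) at each `p`, and the parameter slot at each corner
(`differentiableOn_core214_lastLine_of_primitives`).  No new estimate. [cite: Balaban1988RG2Cluster, (2.14)–(2.15) p.15, (2.16)–(2.22) p.16, (2.23)–(2.25) p.17, (1.41) p.11] -/
theorem differentiableOn_term214_of_primitives_polyτ (hρ : WeightHyp 0 ρ) (hρs : ∀ x y : S, ρ x y = ρ y x)
    (hKc : ∀ b : ℝ, 0 < b → ∀ (T : Finset S) (x : S), ∑ y ∈ T, Real.exp (-(b * ρ x y)) ≤ Kc b)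
    (hKc0 : ∀ b : ℝ, 0 < b → 0 ≤ Kc b) (hW : IsOpen W)
    {Uσ : Set ℂ} {Uτ : κ → Set ℂ} (hUσ : IsOpen Uσ) (hUτ : ∀ Y, IsOpen (Uτ Y)) {r : ℝ} (hr : 0 < r)
    (hsubσ : ∀ s ∈ Set.uIcc (0 : ℝ) 1, closedBall (s : ℂ) r ⊆ Uσ)
    (hsubτ : ∀ Y, ∀ s ∈ Set.uIcc (0 : ℝ) 1, closedBall (s : ℂ) r ⊆ Uτ Y)
    (A : (ι → ℂ) → Matrix Λ Λ ℂ) (Γ : (ι → ℂ) → (Λ ⊕ C₀ → ℝ) → (Λ → ℂ))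
    (cardP : ℕ) (χY₀ χcP : (Λ → ℝ) → ℝ) (hχ0 : ∀ B, 0 ≤ χY₀ B) (hχc0 : ∀ B, 0 ≤ χcP B) (Dfam : Finset κ)
    (V : P → κ → (Λ → ℝ) → ℂ)
    {C : Matrix Λ Λ ℝ} (hC : C.PosDef) (Γ₀ : Matrix Λ (Λ ⊕ C₀) ℝ)
    (hAhol : ∀ i j, DifferentiableOn ℂ (fun σ => A σ i j) {σ | ∀ j, σ j ∈ Uσ})
    (hχm : Measurable χY₀) (hχcm : Measurable χcP)
    -- the potentials in the parameter: measurable in the field, holomorphic in `p`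
    (hVm : ∀ p ∈ W, ∀ Y, Measurable (V p Y)) (hVd : ∀ Y B, DifferentiableOn ℂ (fun p => V p Y B) W)
    (hAs : ∀ σ : ι → ℂ, (∀ j, σ j ∈ Uσ) → (A σ).IsSymm)
    (hA : ∀ σ : ι → ℂ, (∀ j, σ j ∈ Uσ) → ((A σ).map Complex.re).PosDef)
    -- the Γ-operator is linear with kernel G(σ), entrywise holomorphic
    (G : (ι → ℂ) → Matrix Λ (Λ ⊕ C₀) ℂ)
    (hGhol : ∀ i j, DifferentiableOn ℂ (fun σ => G σ i j) {σ | ∀ j, σ j ∈ Uσ})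
    (hlin : ∀ σ : ι → ℂ, (∀ j, σ j ∈ Uσ) → ∀ X : Λ ⊕ C₀ → ℝ, Γ σ X = G σ *ᵥ fun j => (X j : ℂ))
    -- the (2.22) shape, and (2.20) on the open PER-DOMAIN τ-region UNIFORMLY in the parameter
    {γ₂ rP a w : ℝ} (qP : (Λ → ℝ) → ℝ)
    (h222 : ∀ B, χY₀ B * χcP B ≤ Real.exp (-(γ₂ / 2 * rP ^ 2 * cardP) + γ₂ / 2 * qP B)) (hγ₂ : 0 ≤ γ₂)
    (hqP : ∀ B, qP B ≤ B ⬝ᵥ B) (ha0 : 0 ≤ a)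
    (h220U : ∀ p ∈ W, ∀ τ : κ → ℂ, (∀ Y, τ Y ∈ Uτ Y) →
      ∀ B, ∑ Y ∈ Dfam, ‖τ Y‖ * ‖V p Y B‖ ≤ a / 2 * (B ⬝ᵥ B) + w)
    -- located bonds
    (locΛ : Λ → S) (locN : Λ ⊕ C₀ → S) {m : ℕ}
    (hfibΛ : ∀ x : S, (Finset.univ.filter fun i => locΛ i = x).card ≤ m)
    (hfibN : ∀ x : S, (Finset.univ.filter fun j => locN j = x).card ≤ m)
    -- rates and constants
    {kap kap' kap'' θ θE θΓ θC KG KΓ KCs K₀ : ℝ} (hkap'' : 0 < kap'') (h1 : kap'' < kap') (h2 : kap' < kap)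
    (hθE : 0 ≤ θE) (hθΓ : 0 ≤ θΓ) (hθC : 0 ≤ θC) (hKG : 0 ≤ KG) (hKΓ : 0 ≤ KΓ) (hKCs : 0 ≤ KCs) (hK₀ : 0 ≤ K₀)
    (hθEle : θE ≤ θ) (hθΓle : θΓ ≤ θ)
    (hθR1le : (m * Kc (kap - kap')) * (m * Kc (kap' - kap''))
      * (θΓ * KCs * KG + KΓ * θC * KG + KΓ * K₀ * θΓ) ≤ θ)
    -- uniform localisation of the primitive kernels on the open σ-polydisc (L17a)
    (hG : ∀ σ : ι → ℂ, (∀ j, σ j ∈ Uσ) →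
      ∀ b j, ‖G σ b j‖ ≤ KG * Real.exp (-(kap * ρ (locΛ b) (locN j))))
    (hΓ₀ : ∀ b j, ‖Γ₀ b j‖ ≤ KΓ * Real.exp (-(kap * ρ (locΛ b) (locN j))))
    (hCs : ∀ σ : ι → ℂ, (∀ j, σ j ∈ Uσ) →
      ∀ b b', ‖(A σ)⁻¹ b b'‖ ≤ KCs * Real.exp (-(kap * ρ (locΛ b) (locΛ b'))))
    (hC216 : ∀ b b', ‖C b b'‖ ≤ K₀ * Real.exp (-(kap * ρ (locΛ b) (locΛ b'))))
    -- the (2.16)-type differences on the open σ-polydisc (L16a)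
    (hdΓ : ∀ σ : ι → ℂ, (∀ j, σ j ∈ Uσ) →
      ∀ b j, ‖(G σ - Γ₀.map (algebraMap ℝ ℂ)) b j‖ ≤ θΓ * Real.exp (-(kap * ρ (locΛ b) (locN j))))
    (hdC : ∀ σ : ι → ℂ, (∀ j, σ j ∈ Uσ) →
      ∀ b b', ‖((A σ)⁻¹ - C.map (algebraMap ℝ ℂ)) b b'‖ ≤ θC * Real.exp (-(kap * ρ (locΛ b) (locΛ b'))))
    (hdE : ∀ σ : ι → ℂ, (∀ j, σ j ∈ Uσ) →
      ∀ b b', ‖(A σ - C⁻¹.map (algebraMap ℝ ℂ)) b b'‖ ≤ θE * Real.exp (-(kap * ρ (locΛ b) (locΛ b'))))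
    (hsmallKθ : K₀ * (m * Kc kap) * (θ * (m * Kc kap'')) < 1)
    -- the (2.24)–(2.25) smallness
    {c g : ℝ} (hc0 : 0 ≤ c) (hc : ∀ k, hC.1.eigenvalues k ≤ c)
    (hαc : (2 * (θ * (m * Kc kap'')) + (γ₂ + a)) * c ≤ 1 / 2)
    (hΓq : ∀ X : Λ ⊕ C₀ → ℝ, (Γ₀ *ᵥ X) ⬝ᵥ (C *ᵥ (Γ₀ *ᵥ X)) ≤ g * (X ⬝ᵥ X))
    (hsmall : (2 * (θ * (m * Kc kap'')) + (γ₂ + a)) * (1 + 2 * c * g) ≤ 1 / 2)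
    {lZ : List ι} (hlZ : lZ.Nodup) {lD : List κ} (hlD : lD.Nodup)
    {σ₀ : ι → ℂ} (hσ₀ : ∀ j, σ₀ j ∈ Uσ) {τ₀ : κ → ℂ} (hτ₀ : ∀ Y, τ₀ Y ∈ Uτ Y) :
    DifferentiableOn ℂ (fun p => term214 r lZ lD (core214 A Γ (F214 cardP χY₀ χcP Dfam (V p))) σ₀ τ₀) W := by
  have ha2 : 0 ≤ γ₂ + a := add_nonneg hγ₂ ha0
  refine differentiableOn_term214_param_polyτ hUσ hUτ hr hsubσ hsubτ
    (Ψ := fun p => core214 A Γ (F214 cardP χY₀ χcP Dfam (V p))) (fun p hp τ hτ => ?_) (fun p hp σ hσ => ?_)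
    (fun σ τ hσ hτ => ?_) hlZ hlD hσ₀ hτ₀
  · -- the σ-slot at this parameter and this τ
    exact sepHolOn_core214_sigma_of_primitives hρ hρs hKc hKc0 hUσ A Γ G hAhol hGhol hAs hA hlin
      (F214 cardP χY₀ χcP Dfam (V p)) τ (measurable_F214 cardP hχm hχcm Dfam (hVm p hp) τ).stronglyMeasurable
      (K := Real.exp (-(γ₂ / 2 * rP ^ 2 * cardP) + w)) (Real.exp_pos _).le ha2
      (fun B => norm_F214_le cardP χY₀ χcP Dfam (V p) τ qP B (hχ0 B) (hχc0 B) (h222 B) hγ₂ (hqP B) (h220U p hp τ hτ B))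
      hC Γ₀ locΛ locN hfibΛ hfibN hkap'' h1 h2 hθE hθΓ hθC hKG hKΓ hKCs hK₀ hθEle hθΓle hθR1le hG hΓ₀ hCs hC216 hdΓ
      hdC hdE hsmallKθ hc0 hc hαc hΓq hsmall
  · -- the τ-slot at this parameter and this σ, poly class
    exact sepHolOnPoly_core214_tau_of_primitives hρ hρs hKc hKc0 hUτ A Γ G σ (hAs σ hσ) (hA σ hσ) (hlin σ hσ) cardP hχm
      hχcm hχ0 hχc0 Dfam (hVm p hp) qP h222 hγ₂ hqP ha0 (h220U p hp) hC Γ₀ locΛ locN hfibΛ hfibN hkap'' h1 h2 hθE hθΓ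
      hθC hKG hKΓ hKCs hK₀ hθEle hθΓle hθR1le (hG σ hσ) hΓ₀ (hCs σ hσ) hC216 (hdΓ σ hσ) (hdC σ hσ) (hdE σ hσ) hsmallKθ
      hc0 hc hαc hΓq hsmall
  · -- the parameter slot at the corner (σ, τ)
    exact differentiableOn_core214_lastLine_of_primitives hρ hρs hKc hKc0 hW A Γ G σ (hAs σ hσ) (hA σ hσ) (hlin σ hσ)
      cardP hχm hχcm hχ0 hχc0 Dfam hVm hVd τ qP h222 hγ₂ hqP ha0 (fun p hp B => h220U p hp τ hτ B) hC Γ₀ locΛ locN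
      hfibΛ hfibN hkap'' h1 h2 hθE hθΓ hθC hKG hKΓ hKCs hK₀ hθEle hθΓle hθR1le (hG σ hσ) hΓ₀ (hCs σ hσ) hC216
      (hdΓ σ hσ) (hdC σ hσ) (hdE σ hσ) hsmallKθ hc0 hc hαc hΓq hsmall

end Located

/-! ## §4. Torus edition: bonds on [13]'s site torus, base points `σ = 0`, `τ = 0` -/

section Torus

variable {d L N' : ℕ} [NeZero L] [NeZero N']
variable {ν : ℕ} {Nf : Fin ν → ℕ} [∀ i, NeZero (Nf i)]
variable {Λ : Type} [Fintype Λ] [DecidableEq Λ] {C₀ : Type} [Fintype C₀] [DecidableEq C₀]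
variable {P : Type*} [NormedAddCommGroup P] [NormedSpace ℂ P] {W : Set P}

open Classical in
/-- **THE TERM (2.14) OF THE TORUS MODEL IS HOLOMORPHIC IN ANY EXTERNAL PARAMETER ENTERING ONLY THE POTENTIALS** — the torus instance of
`differentiableOn_term214_of_primitives_polyτ`, keyed like the tree's (2.26) joiner `B13Lemma3TorusPrimitivePoly.h226_torus_of_primitives_holo_polyτ`
(bonds located on [13]'s site torus `UT Nf`, torus distance `d₁`, lattice constant `(1 + 2/b)^ν`; σ-parameters `lZ` over cubes of the coarse
torus, τ-parameters `lD` over domains of the fine torus; the σ-region `Uσ ⊇ {|σ| ≤ e^{κ₁}}`, per-domain τ-regions `Uτ Y` containing the contour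
discs; base points `0`): with the potentials parametrised by `p` of an open `W` (`𝐕_p(Y, ·)` measurable, `p ↦ 𝐕_p(Y, B)` holomorphic on `W`,
(2.20) on `Π_Y Uτ Y` uniformly in `p ∈ W`) and every other located input of the joiner that is not size-only,
`p ↦ term214 r lZ lD (core214 A Γ (F214 |P| χ χᶜ 𝐃 𝐕_p)) 0 0` is complex differentiable on `W`.
[cite: Balaban1988RG2Cluster, (2.14)–(2.15) p.15, (2.16)–(2.22) p.16, (2.23)–(2.25) p.17, (1.41) p.11] -/
theorem differentiableOn_term214_torus_of_primitives_holo_polyτ (c : B13.Consts) (hW : IsOpen W)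
    {Uσ : Set ℂ} {Uτ : TDom d (L * N') → Set ℂ} (hUσ : IsOpen Uσ) (hUτ : ∀ Y, IsOpen (Uτ Y))
    (hUexp : closedBall (0 : ℂ) (Real.exp c.κ₁) ⊆ Uσ)
    {r : ℝ} (hr : 0 < r) (hr' : r ≤ Real.exp c.κ₁ - 1)
    (hsubτ : ∀ Y, ∀ s ∈ Set.uIcc (0 : ℝ) 1, closedBall (s : ℂ) r ⊆ Uτ Y)
    -- the parameter lists of the term (distinct cubes ∕ domains)
    {lZ : List (TPt d N')} (hlZ : lZ.Nodup) {lD : List (TDom d (L * N'))} (hlD : lD.Nodup)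
    -- the (2.14)-data of the term, the potentials parametrised
    (A : (TPt d N' → ℂ) → Matrix Λ Λ ℂ) (Γ : (TPt d N' → ℂ) → (Λ ⊕ C₀ → ℝ) → (Λ → ℂ))
    (cardP : ℕ) (χY₀ χcP : (Λ → ℝ) → ℝ) (hχ0 : ∀ B, 0 ≤ χY₀ B) (hχc0 : ∀ B, 0 ≤ χcP B)
    (Dfam : Finset (TDom d (L * N'))) (V : P → TDom d (L * N') → (Λ → ℝ) → ℂ)
    {C : Matrix Λ Λ ℝ} (hC : C.PosDef) (Γ₀ : Matrix Λ (Λ ⊕ C₀) ℝ)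
    (hAhol : ∀ i j, DifferentiableOn ℂ (fun σ => A σ i j) {σ | ∀ j, σ j ∈ Uσ})
    (hχm : Measurable χY₀) (hχcm : Measurable χcP)
    (hVm : ∀ p ∈ W, ∀ Y, Measurable (V p Y)) (hVd : ∀ Y B, DifferentiableOn ℂ (fun p => V p Y B) W)
    (hAs : ∀ σ : TPt d N' → ℂ, (∀ j, σ j ∈ Uσ) → (A σ).IsSymm)
    (hA : ∀ σ : TPt d N' → ℂ, (∀ j, σ j ∈ Uσ) → ((A σ).map Complex.re).PosDef)
    (G : (TPt d N' → ℂ) → Matrix Λ (Λ ⊕ C₀) ℂ)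
    (hGhol : ∀ i j, DifferentiableOn ℂ (fun σ => G σ i j) {σ | ∀ j, σ j ∈ Uσ})
    (hlin : ∀ σ : TPt d N' → ℂ, (∀ j, σ j ∈ Uσ) →
      ∀ X : Λ ⊕ C₀ → ℝ, Γ σ X = G σ *ᵥ fun j => (X j : ℂ))
    {γ₂ rP a₂₀ w : ℝ} (qP : (Λ → ℝ) → ℝ)
    (h222 : ∀ B, χY₀ B * χcP B ≤ Real.exp (-(γ₂ / 2 * rP ^ 2 * cardP) + γ₂ / 2 * qP B)) (hγ₂ : 0 ≤ γ₂)
    (hqP : ∀ B, qP B ≤ B ⬝ᵥ B) (ha0 : 0 ≤ a₂₀)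
    (h220U : ∀ p ∈ W, ∀ τ : TDom d (L * N') → ℂ, (∀ Y, τ Y ∈ Uτ Y) →
      ∀ B, ∑ Y ∈ Dfam, ‖τ Y‖ * ‖V p Y B‖ ≤ a₂₀ / 2 * (B ⬝ᵥ B) + w)
    -- bonds located on the torus `UT Nf`
    (locΛ : Λ → UT Nf) (locN : Λ ⊕ C₀ → UT Nf) {m : ℕ}
    (hfibΛ : ∀ x : UT Nf, (Finset.univ.filter fun i => locΛ i = x).card ≤ m)
    (hfibN : ∀ x : UT Nf, (Finset.univ.filter fun j => locN j = x).card ≤ m)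
    -- rates and constants
    {kap kap' kap'' θ θE θΓ θC KG KΓ KCs K₀ : ℝ} (hkap'' : 0 < kap'') (h1 : kap'' < kap') (h2 : kap' < kap)
    (hθE : 0 ≤ θE) (hθΓ : 0 ≤ θΓ) (hθC : 0 ≤ θC) (hKG : 0 ≤ KG) (hKΓ : 0 ≤ KΓ) (hKCs : 0 ≤ KCs) (hK₀ : 0 ≤ K₀)
    (hθEle : θE ≤ θ) (hθΓle : θΓ ≤ θ)
    (hθR1le : (m * (1 + 2 / (kap - kap')) ^ ν) * (m * (1 + 2 / (kap' - kap'')) ^ ν)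
      * (θΓ * KCs * KG + KΓ * θC * KG + KΓ * K₀ * θΓ) ≤ θ)
    -- uniform localisation of the primitive kernels in the torus distance (L17a), open σ-polydisc
    (hG : ∀ σ : TPt d N' → ℂ, (∀ j, σ j ∈ Uσ) →
      ∀ b j, ‖G σ b j‖ ≤ KG * Real.exp (-(kap * tdist1 Nf (locΛ b) (locN j))))
    (hΓ₀ : ∀ b j, ‖Γ₀ b j‖ ≤ KΓ * Real.exp (-(kap * tdist1 Nf (locΛ b) (locN j))))
    (hCs : ∀ σ : TPt d N' → ℂ, (∀ j, σ j ∈ Uσ) →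
      ∀ b b', ‖(A σ)⁻¹ b b'‖ ≤ KCs * Real.exp (-(kap * tdist1 Nf (locΛ b) (locΛ b'))))
    (hC216 : ∀ b b', ‖C b b'‖ ≤ K₀ * Real.exp (-(kap * tdist1 Nf (locΛ b) (locΛ b'))))
    -- the (2.16)-type differences in the torus distance (L16a), open σ-polydisc
    (hdΓ : ∀ σ : TPt d N' → ℂ, (∀ j, σ j ∈ Uσ) →
      ∀ b j, ‖(G σ - Γ₀.map (algebraMap ℝ ℂ)) b j‖ ≤ θΓ * Real.exp (-(kap * tdist1 Nf (locΛ b) (locN j))))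
    (hdC : ∀ σ : TPt d N' → ℂ, (∀ j, σ j ∈ Uσ) →
      ∀ b b', ‖((A σ)⁻¹ - C.map (algebraMap ℝ ℂ)) b b'‖
        ≤ θC * Real.exp (-(kap * tdist1 Nf (locΛ b) (locΛ b'))))
    (hdE : ∀ σ : TPt d N' → ℂ, (∀ j, σ j ∈ Uσ) →
      ∀ b b', ‖(A σ - C⁻¹.map (algebraMap ℝ ℂ)) b b'‖ ≤ θE * Real.exp (-(kap * tdist1 Nf (locΛ b) (locΛ b'))))
    (hsmallKθ : K₀ * (m * (1 + 2 / kap) ^ ν) * (θ * (m * (1 + 2 / kap'') ^ ν)) < 1)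
    -- the (2.24)–(2.25) smallness
    {cE g : ℝ} (hc0 : 0 ≤ cE) (hc : ∀ k, hC.1.eigenvalues k ≤ cE)
    (hαc : (2 * (θ * (m * (1 + 2 / kap'') ^ ν)) + (γ₂ + a₂₀)) * cE ≤ 1 / 2)
    (hΓq : ∀ X : Λ ⊕ C₀ → ℝ, (Γ₀ *ᵥ X) ⬝ᵥ (C *ᵥ (Γ₀ *ᵥ X)) ≤ g * (X ⬝ᵥ X))
    (hsmall : (2 * (θ * (m * (1 + 2 / kap'') ^ ν)) + (γ₂ + a₂₀)) * (1 + 2 * cE * g) ≤ 1 / 2) :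
    DifferentiableOn ℂ (fun p => term214 r lZ lD (core214 A Γ (F214 cardP χY₀ χcP Dfam (V p))) 0 0) W := by
  have hsubσ : ∀ s ∈ Set.uIcc (0 : ℝ) 1, closedBall (s : ℂ) r ⊆ Uσ :=
    fun s hs => (closedBall_subset_closedBall_of_mem_uIcc hr' hs).trans hUexp
  have h0σ : (0 : ℂ) ∈ Uσ := by simpa using hsubσ 0 (by simp) (mem_closedBall_self hr.le)
  have h0τ : ∀ Y, (0 : ℂ) ∈ Uτ Y := fun Y => by
    simpa using hsubτ Y 0 (by simp) (mem_closedBall_self hr.le)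
  exact differentiableOn_term214_of_primitives_polyτ (ι := TPt d N') (κ := TDom d (L * N'))
    (weightHyp_tdist1 (N := Nf)) tdist1_symm kc_tdist1 kc_l1_nonneg hW hUσ hUτ hr hsubσ hsubτ A Γ cardP χY₀ χcP hχ0 hχc0
    Dfam V hC Γ₀ hAhol hχm hχcm hVm hVd hAs hA G hGhol hlin qP h222 hγ₂ hqP ha0 h220U locΛ locN hfibΛ hfibN hkap'' h1
    h2 hθE hθΓ hθC hKG hKΓ hKCs hK₀ hθEle hθΓle hθR1le hG hΓ₀ hCs hC216 hdΓ hdC hdE hsmallKθ hc0 hc hαc hΓq hsmall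
    hlZ hlD (σ₀ := 0) (fun _ => h0σ) (τ₀ := 0) (fun Y => h0τ Y)

end Torus

/-! ## §5 (v1.1, append-only). The X-integral with the parameter in the KERNELS AND the potentials, from the primitive objects -/

section ParamKernels

variable {S : Type*} [DecidableEq S] {ρ : S → S → ℝ} {Kc : ℝ → ℝ}
variable {Λ : Type} [Fintype Λ] [DecidableEq Λ] {C₀ : Type} [Fintype C₀] [DecidableEq C₀]
variable {ι κ : Type*} [Fintype ι] [DecidableEq ι] [Fintype κ] [DecidableEq κ]
variable {P : Type*} [NormedAddCommGroup P] [NormedSpace ℂ P] {W : Set P}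

omit [Fintype ι] [DecidableEq ι] [Fintype κ] [DecidableEq κ] in
/-- **THE PARAMETER SLOT FROM THE PRIMITIVE OBJECTS WHEN THE PARAMETER ENTERS THE KERNELS TOO, at one `σ`** — §3's
`differentiableOn_core214_lastLine_of_primitives` with the operator families `A_p(σ)`, `G_p(σ)` ALSO depending on the parameter `p ∈ W`:
entrywise complex differentiable in `p` at the given `σ` (`hAd`, `hGd`), and the capstone's σ-letters at that `σ` (symmetry, `Re ≻ 0`, linearity
with kernel `G_p(σ)`, (L17a), (L16a)) holding UNIFORMLY in `p ∈ W` with ONE set of constants; the potentials as in §3.  Conclusion: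
`p ↦ core214 A_p Γ_p (F214 |P| χ χᶜ 𝐃 𝐕_p) σ τ` is complex differentiable on `W` — `B13Core214Holomorphic.differentiableOn_core214X` with the
letters derived pointwise in `p` by the capstone's five lines (the shape of node N18's «corner values holomorphic in the step's DATA» and of
NE5's operator pencil, now from primitive letters uniform on the parameter set; Literature-side twin of the Summit-side
`Spine/NE5/TwoRunTorusPrimitiveParam.differentiableOn_core214_of_primitives_param`, seat ne5).
[cite: Balaban1988RG2Cluster, (2.14)–(2.15) p.15, (2.16)–(2.22) p.16, (2.23)–(2.25) p.17, (1.5) p.3] -/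
theorem differentiableOn_core214_param_of_primitives (hρ : WeightHyp 0 ρ) (hρs : ∀ x y : S, ρ x y = ρ y x)
    (hKc : ∀ b : ℝ, 0 < b → ∀ (T : Finset S) (x : S), ∑ y ∈ T, Real.exp (-(b * ρ x y)) ≤ Kc b)
    (hKc0 : ∀ b : ℝ, 0 < b → 0 ≤ Kc b) (hW : IsOpen W)
    (A : P → (ι → ℂ) → Matrix Λ Λ ℂ) (Γ : P → (ι → ℂ) → (Λ ⊕ C₀ → ℝ) → (Λ → ℂ))
    (G : P → (ι → ℂ) → Matrix Λ (Λ ⊕ C₀) ℂ) (σ : ι → ℂ)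
    (hAd : ∀ i j, DifferentiableOn ℂ (fun p => A p σ i j) W) (hGd : ∀ i j, DifferentiableOn ℂ (fun p => G p σ i j) W)
    (hAs : ∀ p ∈ W, (A p σ).IsSymm) (hA : ∀ p ∈ W, ((A p σ).map Complex.re).PosDef)
    (hlin : ∀ p ∈ W, ∀ X : Λ ⊕ C₀ → ℝ, Γ p σ X = G p σ *ᵥ fun j => (X j : ℂ))
    (cardP : ℕ) {χY₀ χcP : (Λ → ℝ) → ℝ} (hχm : Measurable χY₀) (hχcm : Measurable χcP)
    (hχ0 : ∀ B, 0 ≤ χY₀ B) (hχc0 : ∀ B, 0 ≤ χcP B) (Dfam : Finset κ) {V : P → κ → (Λ → ℝ) → ℂ}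
    (hVm : ∀ p ∈ W, ∀ Y, Measurable (V p Y)) (hVd : ∀ Y B, DifferentiableOn ℂ (fun p => V p Y B) W)
    (τ : κ → ℂ) {γ₂ rP a w : ℝ} (qP : (Λ → ℝ) → ℝ)
    (h222 : ∀ B, χY₀ B * χcP B ≤ Real.exp (-(γ₂ / 2 * rP ^ 2 * cardP) + γ₂ / 2 * qP B)) (hγ₂ : 0 ≤ γ₂)
    (hqP : ∀ B, qP B ≤ B ⬝ᵥ B) (ha0 : 0 ≤ a)
    (h220 : ∀ p ∈ W, ∀ B, ∑ Y ∈ Dfam, ‖τ Y‖ * ‖V p Y B‖ ≤ a / 2 * (B ⬝ᵥ B) + w)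
    {C : Matrix Λ Λ ℝ} (hC : C.PosDef) (Γ₀ : Matrix Λ (Λ ⊕ C₀) ℝ)
    (locΛ : Λ → S) (locN : Λ ⊕ C₀ → S) {m : ℕ}
    (hfibΛ : ∀ x : S, (Finset.univ.filter fun i => locΛ i = x).card ≤ m)
    (hfibN : ∀ x : S, (Finset.univ.filter fun j => locN j = x).card ≤ m)
    {kap kap' kap'' θ θE θΓ θC KG KΓ KCs K₀ : ℝ} (hkap'' : 0 < kap'') (h1 : kap'' < kap') (h2 : kap' < kap)
    (hθE : 0 ≤ θE) (hθΓ : 0 ≤ θΓ) (hθC : 0 ≤ θC) (hKG : 0 ≤ KG) (hKΓ : 0 ≤ KΓ) (hKCs : 0 ≤ KCs) (hK₀ : 0 ≤ K₀)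
    (hθEle : θE ≤ θ) (hθΓle : θΓ ≤ θ)
    (hθR1le : (m * Kc (kap - kap')) * (m * Kc (kap' - kap''))
      * (θΓ * KCs * KG + KΓ * θC * KG + KΓ * K₀ * θΓ) ≤ θ)
    (hG : ∀ p ∈ W, ∀ b j, ‖G p σ b j‖ ≤ KG * Real.exp (-(kap * ρ (locΛ b) (locN j))))
    (hΓ₀ : ∀ b j, ‖Γ₀ b j‖ ≤ KΓ * Real.exp (-(kap * ρ (locΛ b) (locN j))))
    (hCs : ∀ p ∈ W, ∀ b b', ‖(A p σ)⁻¹ b b'‖ ≤ KCs * Real.exp (-(kap * ρ (locΛ b) (locΛ b'))))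
    (hC216 : ∀ b b', ‖C b b'‖ ≤ K₀ * Real.exp (-(kap * ρ (locΛ b) (locΛ b'))))
    (hdΓ : ∀ p ∈ W, ∀ b j, ‖(G p σ - Γ₀.map (algebraMap ℝ ℂ)) b j‖ ≤ θΓ * Real.exp (-(kap * ρ (locΛ b) (locN j))))
    (hdC : ∀ p ∈ W, ∀ b b', ‖((A p σ)⁻¹ - C.map (algebraMap ℝ ℂ)) b b'‖ ≤ θC * Real.exp (-(kap * ρ (locΛ b) (locΛ b'))))
    (hdE : ∀ p ∈ W, ∀ b b', ‖(A p σ - C⁻¹.map (algebraMap ℝ ℂ)) b b'‖ ≤ θE * Real.exp (-(kap * ρ (locΛ b) (locΛ b'))))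
    (hsmallKθ : K₀ * (m * Kc kap) * (θ * (m * Kc kap'')) < 1)
    {c g : ℝ} (hc0 : 0 ≤ c) (hc : ∀ k, hC.1.eigenvalues k ≤ c)
    (hαc : (2 * (θ * (m * Kc kap'')) + (γ₂ + a)) * c ≤ 1 / 2)
    (hΓq : ∀ X : Λ ⊕ C₀ → ℝ, (Γ₀ *ᵥ X) ⬝ᵥ (C *ᵥ (Γ₀ *ᵥ X)) ≤ g * (X ⬝ᵥ X))
    (hsmall : (2 * (θ * (m * Kc kap'')) + (γ₂ + a)) * (1 + 2 * c * g) ≤ 1 / 2) :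
    DifferentiableOn ℂ (fun p => core214 (A p) (Γ p) (F214 cardP χY₀ χcP Dfam (V p)) σ τ) W := by
  have hθ : 0 ≤ θ := hθE.trans hθEle
  have hkap : 0 < kap := hkap''.trans (h1.trans h2)
  have hkk : kap'' ≤ kap := (h1.trans h2).le
  have hρ0 : 0 ≤ θ * (m * Kc kap'') := mul_nonneg hθ (mul_nonneg (Nat.cast_nonneg m) (hKc0 _ hkap''))
  -- entrywise (2.16) for R₁, E, R₃ at this σ, pointwise in the parameter
  have h216R1 : ∀ p ∈ W, ∀ b b', ‖(Γ₀ᵀ * C * Γ₀ - ((G p σ)ᵀ * (A p σ)⁻¹ * G p σ).map Complex.re) b b'‖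
      ≤ θ * Real.exp (-(kap'' * ρ (locN b) (locN b'))) := fun p hp b b' =>
    (h216R1_of_factors hρ hρs hKc hKc0 hθΓ hθC hKG hKΓ hKCs hK₀ hkap''.le h1 h2 locΛ locN hfibΛ
      (hdΓ p hp) (hdC p hp) (hG p hp) hΓ₀ (hCs p hp) hC216 b b').trans (mul_le_mul_of_nonneg_right hθR1le (Real.exp_pos _).le)
  have h216E : ∀ p ∈ W, ∀ b b', ‖(A p σ - C⁻¹.map (algebraMap ℝ ℂ)) b b'‖
      ≤ θ * Real.exp (-(kap'' * ρ (locΛ b) (locΛ b'))) := fun p hp b b' =>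
    (entry_bound_mono_rate hρ hθE hkk locΛ locΛ (hdE p hp) b b').trans
      (mul_le_mul_of_nonneg_right hθEle (Real.exp_pos _).le)
  have h216R3 : ∀ p ∈ W, ∀ i j, ‖((G p σ).map Complex.re - Γ₀) i j‖ ≤ θ * Real.exp (-(kap'' * ρ (locΛ i) (locN j))) := by
    intro p hp
    have hmono : ∀ i j, ‖(G p σ - Γ₀.map (algebraMap ℝ ℂ)) i j‖ ≤ θ * Real.exp (-(kap'' * ρ (locΛ i) (locN j))) :=
      fun i j => (entry_bound_mono_rate hρ hθΓ hkk locΛ locN (hdΓ p hp) i j).trans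
        (mul_le_mul_of_nonneg_right hθΓle (Real.exp_pos _).le)
    exact fun i j => h216R3_of_diff hmono i j
  -- the Γ-entries are holomorphic in the parameter: Γ p σ X i = Σ_j G p σ i j X_j
  have hΓd : ∀ (X : Λ ⊕ C₀ → ℝ) (i : Λ), DifferentiableOn ℂ (fun p => Γ p σ X i) W := by
    intro X i
    have e : ∀ p ∈ W, Γ p σ X i = ∑ j, G p σ i j * (X j : ℂ) := fun p hp => by
      rw [hlin p hp X]; rfl
    exact (DifferentiableOn.fun_sum fun j _ => (hGd i j).mul (differentiableOn_const _)).congr e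
  unfold core214
  exact differentiableOn_core214X (A := fun p => A p σ) (Γ := fun p => Γ p σ)
    (F := fun p => F214 cardP χY₀ χcP Dfam (V p) τ) (K := Real.exp (-(γ₂ / 2 * rP ^ 2 * cardP) + w))
    (ρ := θ * (m * Kc kap''))
    (η := K₀ * (m * Kc kap) * (θ * (m * Kc kap'')) * (1 + (1 - K₀ * (m * Kc kap) * (θ * (m * Kc kap'')))⁻¹) / 2)
    (g := g) (Γ₀ := Γ₀) hW hAd hAs hA hΓd (fun p hp => continuous_of_linear (G p σ) (Γ p σ) (hlin p hp))
    (fun B => differentiableOn_F214_param cardP χY₀ χcP Dfam τ B fun Y => hVd Y B)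
    (fun p hp => (measurable_F214 cardP hχm hχcm Dfam (hVm p hp) τ).stronglyMeasurable) hC hρ0 (add_nonneg hγ₂ ha0)
    (Real.exp_pos _).le
    (fun p hp X => hR1_of_entrywise hρ hρs hKc (Γ p σ) Γ₀ _ hθ hkap'' locN hfibN
      (hdef1_of_linear (A p σ) (G p σ) (Γ p σ) (hlin p hp) C Γ₀) (h216R1 p hp) X)
    (fun p hp => h17a_of_entrywise hρ hρs hKc hC (hA p hp) hθ hkap'' hK₀ hkap locΛ hfibΛ hC216 (h216E p hp) hsmallKθ)
    (fun p hp => h17b_of_entrywise hρ hρs hKc hC (hA p hp) hθ hkap'' hK₀ hkap locΛ hfibΛ hC216 (h216E p hp) hsmallKθ)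
    (fun p hp B => hR2_of_entrywise hρ hρs hKc hθ hkap'' locΛ hfibΛ (h216E p hp) B)
    (fun p hp X B => hR3_of_entrywise hρs hKc (Γ p σ) Γ₀ _ hθ hkap'' locΛ locN hfibΛ hfibN
      (hdef3_of_linear (G p σ) (Γ p σ) (hlin p hp) Γ₀) (h216R3 p hp) X B)
    (fun p hp B => norm_F214_le cardP χY₀ χcP Dfam (V p) τ qP B (hχ0 B) (hχc0 B) (h222 B) hγ₂ (hqP B) (h220 p hp B))
    hc0 hc hαc hΓq (lt_of_le_of_lt hsmall (by norm_num))

/-! ## §6 (v1.1). The term (2.14) with the parameter in the kernels and the potentials, per-domain τ-regions -/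

/-- **THE TERM (2.14) IS HOLOMORPHIC IN ANY EXTERNAL PARAMETER ENTERING THE KERNELS AND THE POTENTIALS — from the primitive objects,
per-domain τ-regions.**  §3's `differentiableOn_term214_of_primitives_polyτ` with the operator families `A_p(σ)`, `Γ_p(σ)`, `G_p(σ)` ALSO
parametrised: for every `p ∈ W` the capstone's σ-letters on the open σ-polydisc (entrywise σ-holomorphy of `A_p`, `G_p`; symmetry, `Re ≻ 0`,
linearity; (L17a), (L16a)) with ONE set of constants, and for every σ of the polydisc entrywise `p`-holomorphy of `A_p(σ)`, `G_p(σ)` on `W`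
(`hAd`, `hGd`); the characteristic functions `p`-free with (2.22); the potentials `𝐕_p` as in §3.  Conclusion:
`p ↦ term214 r lZ lD (core214 A_p Γ_p (F214 |P| χ χᶜ 𝐃 𝐕_p)) σ₀ τ₀` is complex differentiable on `W` — §1's corner device with the σ-slot and
the τ-slot at each `p` (`sepHolOn_core214_sigma_of_primitives`, `sepHolOnPoly_core214_tau_of_primitives`) and §5 at each corner.  This is
the «(hol) in the step's DATA» hypothesis of node N18's H-layer datum (`Summit….N18HLayerDatumCauchy`: corner values holomorphic in the data)
and the pencil hypothesis of `Spine/NE5/TwoRunTorusRateCauchy`, now from PRIMITIVE letters uniform on the parameter set; §3 is the case of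
`p`-free kernels.  Literature-side twin of the holomorphy half of the Summit-side `Spine/NE5/TwoRunTorusPrimitiveParam.hol_and_h226_torus_of_primitives_param`
(seat ne5; located index set here, torus in §7). [cite: Balaban1988RG2Cluster, (2.14)–(2.15) p.15, (2.16)–(2.22) p.16, (2.23)–(2.25) p.17, (1.5) p.3, (1.41) p.11] -/
theorem differentiableOn_term214_param_of_primitives_polyτ (hρ : WeightHyp 0 ρ) (hρs : ∀ x y : S, ρ x y = ρ y x)
    (hKc : ∀ b : ℝ, 0 < b → ∀ (T : Finset S) (x : S), ∑ y ∈ T, Real.exp (-(b * ρ x y)) ≤ Kc b)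
    (hKc0 : ∀ b : ℝ, 0 < b → 0 ≤ Kc b) (hW : IsOpen W)
    {Uσ : Set ℂ} {Uτ : κ → Set ℂ} (hUσ : IsOpen Uσ) (hUτ : ∀ Y, IsOpen (Uτ Y)) {r : ℝ} (hr : 0 < r)
    (hsubσ : ∀ s ∈ Set.uIcc (0 : ℝ) 1, closedBall (s : ℂ) r ⊆ Uσ)
    (hsubτ : ∀ Y, ∀ s ∈ Set.uIcc (0 : ℝ) 1, closedBall (s : ℂ) r ⊆ Uτ Y)
    (A : P → (ι → ℂ) → Matrix Λ Λ ℂ) (Γ : P → (ι → ℂ) → (Λ ⊕ C₀ → ℝ) → (Λ → ℂ))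
    (cardP : ℕ) (χY₀ χcP : (Λ → ℝ) → ℝ) (hχ0 : ∀ B, 0 ≤ χY₀ B) (hχc0 : ∀ B, 0 ≤ χcP B) (Dfam : Finset κ)
    (V : P → κ → (Λ → ℝ) → ℂ)
    {C : Matrix Λ Λ ℝ} (hC : C.PosDef) (Γ₀ : Matrix Λ (Λ ⊕ C₀) ℝ)
    -- the kernels in the parameter: σ-holomorphic at each p, p-holomorphic at each σ of the open polydisc
    (hAhol : ∀ p ∈ W, ∀ i j, DifferentiableOn ℂ (fun σ => A p σ i j) {σ | ∀ j, σ j ∈ Uσ})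
    (hAd : ∀ σ : ι → ℂ, (∀ j, σ j ∈ Uσ) → ∀ i j, DifferentiableOn ℂ (fun p => A p σ i j) W)
    (hχm : Measurable χY₀) (hχcm : Measurable χcP)
    -- the potentials in the parameter: measurable in the field, holomorphic in `p`
    (hVm : ∀ p ∈ W, ∀ Y, Measurable (V p Y)) (hVd : ∀ Y B, DifferentiableOn ℂ (fun p => V p Y B) W)
    (hAs : ∀ p ∈ W, ∀ σ : ι → ℂ, (∀ j, σ j ∈ Uσ) → (A p σ).IsSymm)
    (hA : ∀ p ∈ W, ∀ σ : ι → ℂ, (∀ j, σ j ∈ Uσ) → ((A p σ).map Complex.re).PosDef)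
    -- the Γ-operator is linear with kernel G_p(σ), σ-holomorphic at each p and p-holomorphic at each σ
    (G : P → (ι → ℂ) → Matrix Λ (Λ ⊕ C₀) ℂ)
    (hGhol : ∀ p ∈ W, ∀ i j, DifferentiableOn ℂ (fun σ => G p σ i j) {σ | ∀ j, σ j ∈ Uσ})
    (hGd : ∀ σ : ι → ℂ, (∀ j, σ j ∈ Uσ) → ∀ i j, DifferentiableOn ℂ (fun p => G p σ i j) W)
    (hlin : ∀ p ∈ W, ∀ σ : ι → ℂ, (∀ j, σ j ∈ Uσ) → ∀ X : Λ ⊕ C₀ → ℝ, Γ p σ X = G p σ *ᵥ fun j => (X j : ℂ))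
    -- the (2.22) shape, and (2.20) on the open PER-DOMAIN τ-region UNIFORMLY in the parameter
    {γ₂ rP a w : ℝ} (qP : (Λ → ℝ) → ℝ)
    (h222 : ∀ B, χY₀ B * χcP B ≤ Real.exp (-(γ₂ / 2 * rP ^ 2 * cardP) + γ₂ / 2 * qP B)) (hγ₂ : 0 ≤ γ₂)
    (hqP : ∀ B, qP B ≤ B ⬝ᵥ B) (ha0 : 0 ≤ a)
    (h220U : ∀ p ∈ W, ∀ τ : κ → ℂ, (∀ Y, τ Y ∈ Uτ Y) →
      ∀ B, ∑ Y ∈ Dfam, ‖τ Y‖ * ‖V p Y B‖ ≤ a / 2 * (B ⬝ᵥ B) + w)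
    -- located bonds
    (locΛ : Λ → S) (locN : Λ ⊕ C₀ → S) {m : ℕ}
    (hfibΛ : ∀ x : S, (Finset.univ.filter fun i => locΛ i = x).card ≤ m)
    (hfibN : ∀ x : S, (Finset.univ.filter fun j => locN j = x).card ≤ m)
    -- rates and constants (ONE set, uniform in the parameter)
    {kap kap' kap'' θ θE θΓ θC KG KΓ KCs K₀ : ℝ} (hkap'' : 0 < kap'') (h1 : kap'' < kap') (h2 : kap' < kap)
    (hθE : 0 ≤ θE) (hθΓ : 0 ≤ θΓ) (hθC : 0 ≤ θC) (hKG : 0 ≤ KG) (hKΓ : 0 ≤ KΓ) (hKCs : 0 ≤ KCs) (hK₀ : 0 ≤ K₀)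
    (hθEle : θE ≤ θ) (hθΓle : θΓ ≤ θ)
    (hθR1le : (m * Kc (kap - kap')) * (m * Kc (kap' - kap''))
      * (θΓ * KCs * KG + KΓ * θC * KG + KΓ * K₀ * θΓ) ≤ θ)
    -- localisation of the primitive kernels on the open σ-polydisc, uniform in the parameter (L17a)
    (hG : ∀ p ∈ W, ∀ σ : ι → ℂ, (∀ j, σ j ∈ Uσ) →
      ∀ b j, ‖G p σ b j‖ ≤ KG * Real.exp (-(kap * ρ (locΛ b) (locN j))))
    (hΓ₀ : ∀ b j, ‖Γ₀ b j‖ ≤ KΓ * Real.exp (-(kap * ρ (locΛ b) (locN j))))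
    (hCs : ∀ p ∈ W, ∀ σ : ι → ℂ, (∀ j, σ j ∈ Uσ) →
      ∀ b b', ‖(A p σ)⁻¹ b b'‖ ≤ KCs * Real.exp (-(kap * ρ (locΛ b) (locΛ b'))))
    (hC216 : ∀ b b', ‖C b b'‖ ≤ K₀ * Real.exp (-(kap * ρ (locΛ b) (locΛ b'))))
    -- the (2.16)-type differences on the open σ-polydisc, uniform in the parameter (L16a)
    (hdΓ : ∀ p ∈ W, ∀ σ : ι → ℂ, (∀ j, σ j ∈ Uσ) →
      ∀ b j, ‖(G p σ - Γ₀.map (algebraMap ℝ ℂ)) b j‖ ≤ θΓ * Real.exp (-(kap * ρ (locΛ b) (locN j))))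
    (hdC : ∀ p ∈ W, ∀ σ : ι → ℂ, (∀ j, σ j ∈ Uσ) →
      ∀ b b', ‖((A p σ)⁻¹ - C.map (algebraMap ℝ ℂ)) b b'‖ ≤ θC * Real.exp (-(kap * ρ (locΛ b) (locΛ b'))))
    (hdE : ∀ p ∈ W, ∀ σ : ι → ℂ, (∀ j, σ j ∈ Uσ) →
      ∀ b b', ‖(A p σ - C⁻¹.map (algebraMap ℝ ℂ)) b b'‖ ≤ θE * Real.exp (-(kap * ρ (locΛ b) (locΛ b'))))
    (hsmallKθ : K₀ * (m * Kc kap) * (θ * (m * Kc kap'')) < 1)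
    -- the (2.24)–(2.25) smallness
    {c g : ℝ} (hc0 : 0 ≤ c) (hc : ∀ k, hC.1.eigenvalues k ≤ c)
    (hαc : (2 * (θ * (m * Kc kap'')) + (γ₂ + a)) * c ≤ 1 / 2)
    (hΓq : ∀ X : Λ ⊕ C₀ → ℝ, (Γ₀ *ᵥ X) ⬝ᵥ (C *ᵥ (Γ₀ *ᵥ X)) ≤ g * (X ⬝ᵥ X))
    (hsmall : (2 * (θ * (m * Kc kap'')) + (γ₂ + a)) * (1 + 2 * c * g) ≤ 1 / 2)
    {lZ : List ι} (hlZ : lZ.Nodup) {lD : List κ} (hlD : lD.Nodup)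
    {σ₀ : ι → ℂ} (hσ₀ : ∀ j, σ₀ j ∈ Uσ) {τ₀ : κ → ℂ} (hτ₀ : ∀ Y, τ₀ Y ∈ Uτ Y) :
    DifferentiableOn ℂ (fun p => term214 r lZ lD (core214 (A p) (Γ p) (F214 cardP χY₀ χcP Dfam (V p))) σ₀ τ₀) W := by
  have ha2 : 0 ≤ γ₂ + a := add_nonneg hγ₂ ha0
  refine differentiableOn_term214_param_polyτ hUσ hUτ hr hsubσ hsubτ
    (Ψ := fun p => core214 (A p) (Γ p) (F214 cardP χY₀ χcP Dfam (V p))) (fun p hp τ hτ => ?_) (fun p hp σ hσ => ?_)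
    (fun σ τ hσ hτ => ?_) hlZ hlD hσ₀ hτ₀
  · -- the σ-slot at this parameter and this τ
    exact sepHolOn_core214_sigma_of_primitives hρ hρs hKc hKc0 hUσ (A p) (Γ p) (G p) (hAhol p hp) (hGhol p hp) (hAs p hp)
      (hA p hp) (hlin p hp) (F214 cardP χY₀ χcP Dfam (V p)) τ
      (measurable_F214 cardP hχm hχcm Dfam (hVm p hp) τ).stronglyMeasurable
      (K := Real.exp (-(γ₂ / 2 * rP ^ 2 * cardP) + w)) (Real.exp_pos _).le ha2
      (fun B => norm_F214_le cardP χY₀ χcP Dfam (V p) τ qP B (hχ0 B) (hχc0 B) (h222 B) hγ₂ (hqP B) (h220U p hp τ hτ B))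
      hC Γ₀ locΛ locN hfibΛ hfibN hkap'' h1 h2 hθE hθΓ hθC hKG hKΓ hKCs hK₀ hθEle hθΓle hθR1le (hG p hp) hΓ₀ (hCs p hp)
      hC216 (hdΓ p hp) (hdC p hp) (hdE p hp) hsmallKθ hc0 hc hαc hΓq hsmall
  · -- the τ-slot at this parameter and this σ, poly class
    exact sepHolOnPoly_core214_tau_of_primitives hρ hρs hKc hKc0 hUτ (A p) (Γ p) (G p) σ (hAs p hp σ hσ) (hA p hp σ hσ)
      (hlin p hp σ hσ) cardP hχm hχcm hχ0 hχc0 Dfam (hVm p hp) qP h222 hγ₂ hqP ha0 (h220U p hp) hC Γ₀ locΛ locN hfibΛ hfibN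
      hkap'' h1 h2 hθE hθΓ hθC hKG hKΓ hKCs hK₀ hθEle hθΓle hθR1le (hG p hp σ hσ) hΓ₀ (hCs p hp σ hσ) hC216 (hdΓ p hp σ hσ)
      (hdC p hp σ hσ) (hdE p hp σ hσ) hsmallKθ hc0 hc hαc hΓq hsmall
  · -- the parameter slot at the corner (σ, τ), kernels and potentials moving with the parameter
    exact differentiableOn_core214_param_of_primitives hρ hρs hKc hKc0 hW A Γ G σ (hAd σ hσ) (hGd σ hσ)
      (fun p hp => hAs p hp σ hσ) (fun p hp => hA p hp σ hσ) (fun p hp => hlin p hp σ hσ) cardP hχm hχcm hχ0 hχc0 Dfam hVm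
      hVd τ qP h222 hγ₂ hqP ha0 (fun p hp B => h220U p hp τ hτ B) hC Γ₀ locΛ locN hfibΛ hfibN hkap'' h1 h2 hθE hθΓ hθC hKG
      hKΓ hKCs hK₀ hθEle hθΓle hθR1le (fun p hp => hG p hp σ hσ) hΓ₀ (fun p hp => hCs p hp σ hσ) hC216
      (fun p hp => hdΓ p hp σ hσ) (fun p hp => hdC p hp σ hσ) (fun p hp => hdE p hp σ hσ) hsmallKθ hc0 hc hαc hΓq hsmall

end ParamKernels

/-! ## §7 (v1.1). Torus edition of §6 -/

section TorusParam

variable {d L N' : ℕ} [NeZero L] [NeZero N']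
variable {ν : ℕ} {Nf : Fin ν → ℕ} [∀ i, NeZero (Nf i)]
variable {Λ : Type} [Fintype Λ] [DecidableEq Λ] {C₀ : Type} [Fintype C₀] [DecidableEq C₀]
variable {P : Type*} [NormedAddCommGroup P] [NormedSpace ℂ P] {W : Set P}

open Classical in
/-- **THE TERM (2.14) OF THE TORUS MODEL IS HOLOMORPHIC IN ANY EXTERNAL PARAMETER ENTERING THE KERNELS AND THE POTENTIALS** — the torus
instance of §6 (bonds on [13]'s site torus `UT Nf`, torus distance `d₁`, lattice constant `(1 + 2/b)^ν`; base points `0`), keyed like §4 with the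
kernel families `A_p`, `Γ_p`, `G_p` parametrised (σ-letters uniform in `p`, `p`-holomorphy at each σ of the polydisc).  The data direction of node
N18's H-layer datum and NE5's pencil at the (2.14) layer, from primitive letters. [cite: Balaban1988RG2Cluster, (2.14)–(2.15) p.15, (2.16)–(2.22) p.16, (2.23)–(2.25) p.17, (1.5) p.3] -/
theorem differentiableOn_term214_torus_param_of_primitives_holo_polyτ (c : B13.Consts) (hW : IsOpen W)
    {Uσ : Set ℂ} {Uτ : TDom d (L * N') → Set ℂ} (hUσ : IsOpen Uσ) (hUτ : ∀ Y, IsOpen (Uτ Y))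
    (hUexp : closedBall (0 : ℂ) (Real.exp c.κ₁) ⊆ Uσ)
    {r : ℝ} (hr : 0 < r) (hr' : r ≤ Real.exp c.κ₁ - 1)
    (hsubτ : ∀ Y, ∀ s ∈ Set.uIcc (0 : ℝ) 1, closedBall (s : ℂ) r ⊆ Uτ Y)
    {lZ : List (TPt d N')} (hlZ : lZ.Nodup) {lD : List (TDom d (L * N'))} (hlD : lD.Nodup)
    (A : P → (TPt d N' → ℂ) → Matrix Λ Λ ℂ) (Γ : P → (TPt d N' → ℂ) → (Λ ⊕ C₀ → ℝ) → (Λ → ℂ))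
    (cardP : ℕ) (χY₀ χcP : (Λ → ℝ) → ℝ) (hχ0 : ∀ B, 0 ≤ χY₀ B) (hχc0 : ∀ B, 0 ≤ χcP B)
    (Dfam : Finset (TDom d (L * N'))) (V : P → TDom d (L * N') → (Λ → ℝ) → ℂ)
    {C : Matrix Λ Λ ℝ} (hC : C.PosDef) (Γ₀ : Matrix Λ (Λ ⊕ C₀) ℝ)
    (hAhol : ∀ p ∈ W, ∀ i j, DifferentiableOn ℂ (fun σ => A p σ i j) {σ | ∀ j, σ j ∈ Uσ})
    (hAd : ∀ σ : TPt d N' → ℂ, (∀ j, σ j ∈ Uσ) → ∀ i j, DifferentiableOn ℂ (fun p => A p σ i j) W)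
    (hχm : Measurable χY₀) (hχcm : Measurable χcP)
    (hVm : ∀ p ∈ W, ∀ Y, Measurable (V p Y)) (hVd : ∀ Y B, DifferentiableOn ℂ (fun p => V p Y B) W)
    (hAs : ∀ p ∈ W, ∀ σ : TPt d N' → ℂ, (∀ j, σ j ∈ Uσ) → (A p σ).IsSymm)
    (hA : ∀ p ∈ W, ∀ σ : TPt d N' → ℂ, (∀ j, σ j ∈ Uσ) → ((A p σ).map Complex.re).PosDef)
    (G : P → (TPt d N' → ℂ) → Matrix Λ (Λ ⊕ C₀) ℂ)
    (hGhol : ∀ p ∈ W, ∀ i j, DifferentiableOn ℂ (fun σ => G p σ i j) {σ | ∀ j, σ j ∈ Uσ})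
    (hGd : ∀ σ : TPt d N' → ℂ, (∀ j, σ j ∈ Uσ) → ∀ i j, DifferentiableOn ℂ (fun p => G p σ i j) W)
    (hlin : ∀ p ∈ W, ∀ σ : TPt d N' → ℂ, (∀ j, σ j ∈ Uσ) →
      ∀ X : Λ ⊕ C₀ → ℝ, Γ p σ X = G p σ *ᵥ fun j => (X j : ℂ))
    {γ₂ rP a₂₀ w : ℝ} (qP : (Λ → ℝ) → ℝ)
    (h222 : ∀ B, χY₀ B * χcP B ≤ Real.exp (-(γ₂ / 2 * rP ^ 2 * cardP) + γ₂ / 2 * qP B)) (hγ₂ : 0 ≤ γ₂)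
    (hqP : ∀ B, qP B ≤ B ⬝ᵥ B) (ha0 : 0 ≤ a₂₀)
    (h220U : ∀ p ∈ W, ∀ τ : TDom d (L * N') → ℂ, (∀ Y, τ Y ∈ Uτ Y) →
      ∀ B, ∑ Y ∈ Dfam, ‖τ Y‖ * ‖V p Y B‖ ≤ a₂₀ / 2 * (B ⬝ᵥ B) + w)
    (locΛ : Λ → UT Nf) (locN : Λ ⊕ C₀ → UT Nf) {m : ℕ}
    (hfibΛ : ∀ x : UT Nf, (Finset.univ.filter fun i => locΛ i = x).card ≤ m)
    (hfibN : ∀ x : UT Nf, (Finset.univ.filter fun j => locN j = x).card ≤ m)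
    {kap kap' kap'' θ θE θΓ θC KG KΓ KCs K₀ : ℝ} (hkap'' : 0 < kap'') (h1 : kap'' < kap') (h2 : kap' < kap)
    (hθE : 0 ≤ θE) (hθΓ : 0 ≤ θΓ) (hθC : 0 ≤ θC) (hKG : 0 ≤ KG) (hKΓ : 0 ≤ KΓ) (hKCs : 0 ≤ KCs) (hK₀ : 0 ≤ K₀)
    (hθEle : θE ≤ θ) (hθΓle : θΓ ≤ θ)
    (hθR1le : (m * (1 + 2 / (kap - kap')) ^ ν) * (m * (1 + 2 / (kap' - kap'')) ^ ν)
      * (θΓ * KCs * KG + KΓ * θC * KG + KΓ * K₀ * θΓ) ≤ θ)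
    (hG : ∀ p ∈ W, ∀ σ : TPt d N' → ℂ, (∀ j, σ j ∈ Uσ) →
      ∀ b j, ‖G p σ b j‖ ≤ KG * Real.exp (-(kap * tdist1 Nf (locΛ b) (locN j))))
    (hΓ₀ : ∀ b j, ‖Γ₀ b j‖ ≤ KΓ * Real.exp (-(kap * tdist1 Nf (locΛ b) (locN j))))
    (hCs : ∀ p ∈ W, ∀ σ : TPt d N' → ℂ, (∀ j, σ j ∈ Uσ) →
      ∀ b b', ‖(A p σ)⁻¹ b b'‖ ≤ KCs * Real.exp (-(kap * tdist1 Nf (locΛ b) (locΛ b'))))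
    (hC216 : ∀ b b', ‖C b b'‖ ≤ K₀ * Real.exp (-(kap * tdist1 Nf (locΛ b) (locΛ b'))))
    (hdΓ : ∀ p ∈ W, ∀ σ : TPt d N' → ℂ, (∀ j, σ j ∈ Uσ) →
      ∀ b j, ‖(G p σ - Γ₀.map (algebraMap ℝ ℂ)) b j‖ ≤ θΓ * Real.exp (-(kap * tdist1 Nf (locΛ b) (locN j))))
    (hdC : ∀ p ∈ W, ∀ σ : TPt d N' → ℂ, (∀ j, σ j ∈ Uσ) →
      ∀ b b', ‖((A p σ)⁻¹ - C.map (algebraMap ℝ ℂ)) b b'‖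
        ≤ θC * Real.exp (-(kap * tdist1 Nf (locΛ b) (locΛ b'))))
    (hdE : ∀ p ∈ W, ∀ σ : TPt d N' → ℂ, (∀ j, σ j ∈ Uσ) →
      ∀ b b', ‖(A p σ - C⁻¹.map (algebraMap ℝ ℂ)) b b'‖ ≤ θE * Real.exp (-(kap * tdist1 Nf (locΛ b) (locΛ b'))))
    (hsmallKθ : K₀ * (m * (1 + 2 / kap) ^ ν) * (θ * (m * (1 + 2 / kap'') ^ ν)) < 1)
    {cE g : ℝ} (hc0 : 0 ≤ cE) (hc : ∀ k, hC.1.eigenvalues k ≤ cE)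
    (hαc : (2 * (θ * (m * (1 + 2 / kap'') ^ ν)) + (γ₂ + a₂₀)) * cE ≤ 1 / 2)
    (hΓq : ∀ X : Λ ⊕ C₀ → ℝ, (Γ₀ *ᵥ X) ⬝ᵥ (C *ᵥ (Γ₀ *ᵥ X)) ≤ g * (X ⬝ᵥ X))
    (hsmall : (2 * (θ * (m * (1 + 2 / kap'') ^ ν)) + (γ₂ + a₂₀)) * (1 + 2 * cE * g) ≤ 1 / 2) :
    DifferentiableOn ℂ (fun p => term214 r lZ lD (core214 (A p) (Γ p) (F214 cardP χY₀ χcP Dfam (V p))) 0 0) W := by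
  have hsubσ : ∀ s ∈ Set.uIcc (0 : ℝ) 1, closedBall (s : ℂ) r ⊆ Uσ :=
    fun s hs => (closedBall_subset_closedBall_of_mem_uIcc hr' hs).trans hUexp
  have h0σ : (0 : ℂ) ∈ Uσ := by simpa using hsubσ 0 (by simp) (mem_closedBall_self hr.le)
  have h0τ : ∀ Y, (0 : ℂ) ∈ Uτ Y := fun Y => by
    simpa using hsubτ Y 0 (by simp) (mem_closedBall_self hr.le)
  exact differentiableOn_term214_param_of_primitives_polyτ (ι := TPt d N') (κ := TDom d (L * N'))
    (weightHyp_tdist1 (N := Nf)) tdist1_symm kc_tdist1 kc_l1_nonneg hW hUσ hUτ hr hsubσ hsubτ A Γ cardP χY₀ χcP hχ0 hχc0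
    Dfam V hC Γ₀ hAhol hAd hχm hχcm hVm hVd hAs hA G hGhol hGd hlin qP h222 hγ₂ hqP ha0 h220U locΛ locN hfibΛ hfibN
    hkap'' h1 h2 hθE hθΓ hθC hKG hKΓ hKCs hK₀ hθEle hθΓle hθR1le hG hΓ₀ hCs hC216 hdΓ hdC hdE hsmallKθ hc0 hc hαc hΓq
    hsmall hlZ hlD (σ₀ := 0) (fun _ => h0σ) (τ₀ := 0) (fun Y => h0τ Y)

end TorusParam

end Literature.MathematicalPhysics.QuantumFieldTheory.Balaban1983to89.B13Term214ParamHolo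

end
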